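import Literature.Probability.LatticeModels.InterfaceSLE
import Literature.Probability.LatticeModels.PlanarIsingDiscApprox
import HarnessLib

/-!
# An admissible square-lattice discretisation of the unit disc (`IsDiscretisation` is satisfiable)

Topic `Literature/Probability/LatticeModels` (family `crit-ising`); theorems and three explicit
definitions, no named fact.

The S17 statements `convergesInLawToSLE_three_isingInterface`,
`convergesInLawToSLE_sixteen_thirds_fkInterface` (`InterfaceSLE.lean`), Smirnov's observable
theorem in the form `fkIsingObservable_tendstoLocallyUniformlyOn_sqrt_deriv_of_isDiscretisation`
(`Sweep1Proofs.lean`) and `SLE6LimitZ2AllDiscretisations` (`Percolation/`) all quantify over a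
Dobrushin domain `D` and a family `E : ℝ → DiscreteDobrushin` of G02 discrete Dobrushin data under
the hypothesis `IsDiscretisation D E`, whose field `eventually_isZdAdmissible` asks for the
delicate combinatorial admissibility `DiscreteDobrushin.IsZdAdmissible` (disjoint discrete arcs
covering the square-lattice boundary, exactly two `A`–`B` edges, each bordering exactly one inner
face) at all small meshes. `Percolation/CanonicalDiscretisationTies.lean` shows that the
*canonical* data of the unit disc (arcs the two half circles) are admissible at **no** mesh (the
last lattice site on the real axis is a tie site of the two discrete arcs), and
`Percolation/InterfaceScalingLimitDiscretised.lean` records that no family with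
`IsDiscretisation D E` had been constructed for any `D`. This file constructs one, for
`D = DobrushinDomain.unitDisc` (marked points `1`, `-1`):

* `tiltUp δ`, `tiltLo δ` — the unit circle cut by the line `im z = (δ/2) re z` through the origin,
  tilted by the mesh-dependent angle `arctan (δ/2)`; `discData δ = ⟨𝔻, δ, tiltUp δ, tiltLo δ⟩`;
* `isZdAdmissible_discData` — for `0 < δ < 1/2` the data are admissible: a boundary site strictly
  above the line is in the discrete arc of `A` only, strictly below in that of `B` only
  (`mem_zdArcA_of_pos`, `mem_zdArcB_of_neg`, from the elementary `one_sub_norm_lt_dist`: a point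
  `p` of the open disc strictly on one side of a line through `0` is at distance `> 1 - ‖p‖` from
  every point of the circle on the other closed side), no boundary site lies on the line (only the
  origin does), and the `A`–`B` edges are exactly the two vertical edges
  `{(M, 1), (M, 0)}`, `{(-M, 0), (-M, -1)}` with `M = abCol δ` the largest natural number with
  `δ² (M² + 1) < 1` (`zdABEdges_discData`);
* `isDiscretisation_discData : IsDiscretisation DobrushinDomain.unitDisc discData` — the tilted
  arcs are within Hausdorff distance `2δ` of the half circles and the two discrete marked points
  `±(δM + iδ/2)` within `3δ` of `±1`;
* `exists_isDiscretisation` — hence the hypothesis of the S17 statements is satisfiable.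

## References

* D. Chelkak, H. Duminil-Copin, C. Hongler, A. Kemppainen, S. Smirnov, *Convergence of Ising
  interfaces to Schramm's SLE curves*, C. R. Math. Acad. Sci. Paris 352 (2014) 157–161, §1
  (discrete domains `(Ω_δ; a_δ, b_δ)` approximating `(Ω; a, b)`). [CDHKSCRAS2014]
* S. Smirnov, *Critical percolation in the plane*, C. R. Acad. Sci. Paris 333 (2001), §2 (discrete
  arcs: the boundary vertices closest to the continuum arcs). [Smirnov2001]
-/

noncomputable section

open Filter Topology Metric Set
open Literature.Probability.RandomPlanarGeometry

namespace Literature.Probability.LatticeModels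

namespace UnitDiscDiscretisation

/-! ### The tilt functional and the tilted arcs -/

/-- The tilt functional `ℓ_δ(v) = im v - (δ/2) re v`; its zero set is the line through `0` of
slope `δ/2`. [folklore] -/
def tilt (δ : ℝ) (v : ℂ) : ℝ := v.im - δ / 2 * v.re

/-- The tilted upper arc: points of the unit circle on or above the line `im = (δ/2) re`
(it plays the arc `(a_δ b_δ)` of CDHKS's approximating domains, C. R. Math. 352 (2014), §1;
the tilt removes the tie site `(M, 0)` of the canonical half-circle arcs). [folklore] -/
def tiltUp (δ : ℝ) : Set ℂ := {w | ‖w‖ = 1 ∧ 0 ≤ tilt δ w}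

/-- The tilted lower arc: points of the unit circle on or below the line `im = (δ/2) re`
(the arc `(b_δ a_δ)`; CDHKS 2014, §1). [folklore] -/
def tiltLo (δ : ℝ) : Set ℂ := {w | ‖w‖ = 1 ∧ tilt δ w ≤ 0}

/-- The discrete Dobrushin data of the unit disc at mesh `δ` with the tilted arcs: domain `𝔻`,
mesh `δ`, `A = tiltUp δ`, `B = tiltLo δ` (a CDHKS-type approximation `(Ω_δ; a_δ, b_δ)` of
`(𝔻; 1, -1)`, C. R. Math. 352 (2014), §1). [folklore] -/
def discData (δ : ℝ) : DiscreteDobrushin := ⟨ball (0 : ℂ) 1, δ, tiltUp δ, tiltLo δ⟩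

/-- The domain of the data is the open unit disc. [folklore] -/
@[simp] theorem discData_Ω (δ : ℝ) : (discData δ).Ω = ball (0 : ℂ) 1 := rfl
/-- The mesh of the data at mesh `δ` is `δ`. [folklore] -/
@[simp] theorem discData_δ (δ : ℝ) : (discData δ).δ = δ := rfl
/-- The arc `A` of the data is the tilted upper arc. [folklore] -/
@[simp] theorem discData_arcA (δ : ℝ) : (discData δ).arcA = tiltUp δ := rfl
/-- The arc `B` of the data is the tilted lower arc. [folklore] -/
@[simp] theorem discData_arcB (δ : ℝ) : (discData δ).arcB = tiltLo δ := rfl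

/-- The tilt functional is odd. [folklore] -/
theorem tilt_neg (δ : ℝ) (v : ℂ) : tilt δ (-v) = -tilt δ v := by
  simp [tilt]; ring

/-- The tilt functional is homogeneous under real scalars. [folklore] -/
theorem tilt_smul (δ : ℝ) (c : ℝ) (v : ℂ) : tilt δ ((c : ℂ) * v) = c * tilt δ v := by
  simp [tilt]; ring

/-- The two tilted arcs cover the unit circle. [folklore] -/
theorem tiltUp_union_tiltLo (δ : ℝ) : tiltUp δ ∪ tiltLo δ = sphere (0 : ℂ) 1 := by
  ext w
  simp only [tiltUp, tiltLo, mem_union, mem_setOf_eq, mem_sphere_iff_norm, sub_zero]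
  constructor
  · rintro (⟨h, -⟩ | ⟨h, -⟩) <;> exact h
  · intro h
    rcases le_total 0 (tilt δ w) with h' | h'
    · exact Or.inl ⟨h, h'⟩
    · exact Or.inr ⟨h, h'⟩

/-- The tilted upper arc lies on the unit circle. [folklore] -/
theorem tiltUp_subset_sphere (δ : ℝ) : tiltUp δ ⊆ sphere (0 : ℂ) 1 := fun w hw => by
  rw [mem_sphere_iff_norm, sub_zero]; exact hw.1

/-- The tilted lower arc lies on the unit circle. [folklore] -/
theorem tiltLo_subset_sphere (δ : ℝ) : tiltLo δ ⊆ sphere (0 : ℂ) 1 := fun w hw => by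
  rw [mem_sphere_iff_norm, sub_zero]; exact hw.1

/-- The tilted upper arc is compact (closed in the unit circle). [folklore] -/
theorem isCompact_tiltUp (δ : ℝ) : IsCompact (tiltUp δ) := by
  refine (isCompact_sphere (0 : ℂ) 1).of_isClosed_subset ?_ (tiltUp_subset_sphere δ)
  have h1 : IsClosed {w : ℂ | ‖w‖ = 1} := isClosed_eq continuous_norm continuous_const
  have h2 : IsClosed {w : ℂ | 0 ≤ tilt δ w} := by
    refine isClosed_le continuous_const ?_
    unfold tilt
    fun_prop
  exact h1.inter h2

/-- The tilted lower arc is compact (closed in the unit circle). [folklore] -/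
theorem isCompact_tiltLo (δ : ℝ) : IsCompact (tiltLo δ) := by
  refine (isCompact_sphere (0 : ℂ) 1).of_isClosed_subset ?_ (tiltLo_subset_sphere δ)
  have h1 : IsClosed {w : ℂ | ‖w‖ = 1} := isClosed_eq continuous_norm continuous_const
  have h2 : IsClosed {w : ℂ | tilt δ w ≤ 0} := by
    refine isClosed_le ?_ continuous_const
    unfold tilt
    fun_prop
  exact h1.inter h2

/-- The tilt of `i` is `1`: `i` lies strictly above every tilt line (and `-i` strictly below).
[folklore] -/
theorem tilt_I (δ : ℝ) : tilt δ Complex.I = 1 := by simp [tilt]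

/-- `i` lies on the tilted upper arc. [folklore] -/
theorem I_mem_tiltUp (δ : ℝ) : Complex.I ∈ tiltUp δ := ⟨by simp, by rw [tilt_I]; exact zero_le_one⟩

/-- `-i` lies on the tilted lower arc. [folklore] -/
theorem neg_I_mem_tiltLo (δ : ℝ) : -Complex.I ∈ tiltLo δ :=
  ⟨by simp, by rw [tilt_neg, tilt_I]; norm_num⟩

/-! ### The core metric lemma -/

/-- **Core metric lemma.** A point `p` strictly above a line through the origin is at distance
`> 1 - ‖p‖` from every point `w` of the unit circle on or below that line (for `‖p‖ < 1`: the
nearest point `p/‖p‖` of the circle is strictly above). Elementary. [folklore] -/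
theorem one_sub_norm_lt_dist {α β : ℝ} {p w : ℂ} (hw : ‖w‖ = 1)
    (hpos : 0 < α * p.re + β * p.im) (hle : α * w.re + β * w.im ≤ 0) :
    1 - ‖p‖ < dist p w := by
  set a := p.re with ha
  set b := p.im with hb
  set c := w.re with hc
  set d := w.im with hd
  set r := ‖p‖ with hr
  have hcd : c * c + d * d = 1 := by
    have : ‖w‖ ^ 2 = c * c + d * d := by rw [Complex.sq_norm, Complex.normSq_apply]
    rw [hw] at this; linarith
  have hr2 : r ^ 2 = a * a + b * b := by rw [hr, Complex.sq_norm, Complex.normSq_apply]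
  have hr0 : 0 ≤ r := norm_nonneg _
  have hrpos : 0 < r := by
    rcases hr0.lt_or_eq with h | h
    · exact h
    · exfalso
      have hab : a * a + b * b = 0 := by rw [← hr2, ← h]; ring
      have ha0 : a = 0 := by nlinarith
      have hb0 : b = 0 := by nlinarith
      rw [ha0, hb0] at hpos
      simp at hpos
  -- key inequality: `⟨p, w⟩ < ‖p‖`
  have key : a * c + b * d < r := by
    by_cases hs : a * c + b * d ≤ 0
    · exact lt_of_le_of_lt hs hrpos
    push Not at hs
    by_contra hcon
    push Not at hcon
    -- `r ≤ ac + bd`, so `r² ≤ (ac+bd)²`, forcing `ad = bc`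
    have h1 : r ^ 2 ≤ (a * c + b * d) ^ 2 := by
      exact pow_le_pow_left₀ hr0 hcon 2
    have hid : a * a + b * b = (a * c + b * d) ^ 2 + (a * d - b * c) ^ 2 := by
      nlinarith [hcd]
    have h2 : (a * d - b * c) ^ 2 ≤ 0 := by nlinarith [h1, hid, hr2]
    have h3 : a * d - b * c = 0 := by
      have := sq_nonneg (a * d - b * c)
      exact pow_eq_zero_iff (n := 2) (by norm_num) |>.1 (le_antisymm h2 this)
    -- then `p = (ac+bd) w`
    have h4 : a = c * (a * c + b * d) := by nlinarith [hcd, h3]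
    have h5 : b = d * (a * c + b * d) := by nlinarith [hcd, h3]
    have h6 : α * a + β * b = (a * c + b * d) * (α * c + β * d) := by
      linear_combination α * h4 + β * h5
    have h7 : (a * c + b * d) * (α * c + β * d) ≤ 0 :=
      mul_nonpos_of_nonneg_of_nonpos hs.le hle
    linarith
  have hdist : dist p w ^ 2 = (a - c) * (a - c) + (b - d) * (b - d) := by
    rw [Complex.dist_eq, Complex.sq_norm, Complex.normSq_apply, Complex.sub_re, Complex.sub_im]
  have hlt : (1 - r) ^ 2 < dist p w ^ 2 := by
    rw [hdist]; nlinarith [key, hcd, hr2]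
  exact lt_of_pow_lt_pow_left₀ 2 dist_nonneg hlt

/-- For a point of the open disc strictly above the line, the distance to the tilted upper arc is
at most `1 - ‖p‖` (the radial projection lies on it). [folklore] -/
theorem infDist_tiltUp_le {δ : ℝ} {p : ℂ} (hp : ‖p‖ < 1) (hpos : 0 < tilt δ p) :
    infDist p (tiltUp δ) ≤ 1 - ‖p‖ := by
  have hp0 : p ≠ 0 := by rintro rfl; simp [tilt] at hpos
  have hn : 0 < ‖p‖ := norm_pos_iff.2 hp0
  set u : ℂ := ((‖p‖⁻¹ : ℝ) : ℂ) * p with hu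
  have hu1 : ‖u‖ = 1 := by
    rw [hu, norm_mul, Complex.norm_real, Real.norm_eq_abs, abs_of_pos (inv_pos.2 hn),
      inv_mul_cancel₀ hn.ne']
  have hut : 0 ≤ tilt δ u := by
    rw [hu, tilt_smul]; positivity
  have hmem : u ∈ tiltUp δ := ⟨hu1, hut⟩
  refine (infDist_le_dist_of_mem hmem).trans (le_of_eq ?_)
  rw [dist_comm, dist_eq_norm, hu]
  have : ((‖p‖⁻¹ : ℝ) : ℂ) * p - p = (((‖p‖⁻¹ - 1 : ℝ)) : ℂ) * p := by push_cast; ring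
  rw [this, norm_mul, Complex.norm_real, Real.norm_eq_abs]
  have h1 : 0 ≤ ‖p‖⁻¹ - 1 := by
    rw [sub_nonneg]; exact (one_le_inv₀ hn).2 hp.le
  rw [abs_of_nonneg h1, sub_mul, inv_mul_cancel₀ hn.ne', one_mul]

/-- Symmetric statement below the line. [folklore] -/
theorem infDist_tiltLo_le {δ : ℝ} {p : ℂ} (hp : ‖p‖ < 1) (hneg : tilt δ p < 0) :
    infDist p (tiltLo δ) ≤ 1 - ‖p‖ := by
  have hp0 : p ≠ 0 := by rintro rfl; simp [tilt] at hneg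
  have hn : 0 < ‖p‖ := norm_pos_iff.2 hp0
  set u : ℂ := ((‖p‖⁻¹ : ℝ) : ℂ) * p with hu
  have hu1 : ‖u‖ = 1 := by
    rw [hu, norm_mul, Complex.norm_real, Real.norm_eq_abs, abs_of_pos (inv_pos.2 hn),
      inv_mul_cancel₀ hn.ne']
  have hut : tilt δ u ≤ 0 := by
    rw [hu, tilt_smul]
    exact mul_nonpos_of_nonneg_of_nonpos (inv_pos.2 hn).le hneg.le
  have hmem : u ∈ tiltLo δ := ⟨hu1, hut⟩
  refine (infDist_le_dist_of_mem hmem).trans (le_of_eq ?_)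
  rw [dist_comm, dist_eq_norm, hu]
  have : ((‖p‖⁻¹ : ℝ) : ℂ) * p - p = (((‖p‖⁻¹ - 1 : ℝ)) : ℂ) * p := by push_cast; ring
  rw [this, norm_mul, Complex.norm_real, Real.norm_eq_abs]
  have h1 : 0 ≤ ‖p‖⁻¹ - 1 := by
    rw [sub_nonneg]; exact (one_le_inv₀ hn).2 hp.le
  rw [abs_of_nonneg h1, sub_mul, inv_mul_cancel₀ hn.ne', one_mul]

/-- For a point strictly above the line, the tilted lower arc is at distance `> 1 - ‖p‖`.
[folklore] -/
theorem one_sub_norm_lt_infDist_tiltLo {δ : ℝ} {p : ℂ} (hpos : 0 < tilt δ p) :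
    1 - ‖p‖ < infDist p (tiltLo δ) := by
  obtain ⟨w, hw, hpw⟩ := (isCompact_tiltLo δ).exists_infDist_eq_dist ⟨_, neg_I_mem_tiltLo δ⟩ p
  rw [hpw]
  refine one_sub_norm_lt_dist (α := -(δ / 2)) (β := 1) hw.1 ?_ ?_
  · simp only [tilt] at hpos; linarith
  · have := hw.2; simp only [tilt] at this; linarith

/-- For a point strictly below the line, the tilted upper arc is at distance `> 1 - ‖p‖`.
[folklore] -/
theorem one_sub_norm_lt_infDist_tiltUp {δ : ℝ} {p : ℂ} (hneg : tilt δ p < 0) :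
    1 - ‖p‖ < infDist p (tiltUp δ) := by
  obtain ⟨w, hw, hpw⟩ := (isCompact_tiltUp δ).exists_infDist_eq_dist ⟨_, I_mem_tiltUp δ⟩ p
  rw [hpw]
  refine one_sub_norm_lt_dist (α := δ / 2) (β := -1) hw.1 ?_ ?_
  · simp only [tilt] at hneg; linarith
  · have := hw.2; simp only [tilt] at this; linarith


/-- The radial projection of a nonzero point of the plane to the unit circle keeps the sign of
the tilt functional and is at distance `1 - ‖p‖` when `‖p‖ < 1`. [folklore] -/
theorem exists_proj {δ : ℝ} {p : ℂ} (hp : ‖p‖ < 1) (hp0 : p ≠ 0) :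
    ∃ u : ℂ, ‖u‖ = 1 ∧ dist p u = 1 - ‖p‖ ∧ tilt δ u = ‖p‖⁻¹ * tilt δ p := by
  have hn : 0 < ‖p‖ := norm_pos_iff.2 hp0
  refine ⟨((‖p‖⁻¹ : ℝ) : ℂ) * p, ?_, ?_, by rw [tilt_smul]⟩
  · rw [norm_mul, Complex.norm_real, Real.norm_eq_abs, abs_of_pos (inv_pos.2 hn),
      inv_mul_cancel₀ hn.ne']
  · rw [dist_comm, dist_eq_norm]
    have : ((‖p‖⁻¹ : ℝ) : ℂ) * p - p = (((‖p‖⁻¹ - 1 : ℝ)) : ℂ) * p := by push_cast; ring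
    rw [this, norm_mul, Complex.norm_real, Real.norm_eq_abs]
    have h1 : 0 ≤ ‖p‖⁻¹ - 1 := by
      rw [sub_nonneg]; exact (one_le_inv₀ hn).2 hp.le
    rw [abs_of_nonneg h1, sub_mul, inv_mul_cancel₀ hn.ne', one_mul]

/-! ### The discrete arcs of the tilted data: sites above the line are `A`, below are `B` -/

/-- The frontier of the domain of the data is the unit circle. [folklore] -/
theorem frontier_discData_Ω (δ : ℝ) : frontier (discData δ).Ω = sphere (0 : ℂ) 1 := by
  rw [discData_Ω, frontier_ball (0 : ℂ) one_ne_zero]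

/-- The discrete domain of the data is the set of sites `x` with `‖δx‖ < 1`
(`UnitDisc.mem_meshDomain_ball`). [folklore] -/
theorem mem_meshDomain_discData {δ : ℝ} {x : Site 2} :
    x ∈ meshDomain (discData δ).Ω (discData δ).δ ↔ ‖meshPoint δ x‖ < 1 :=
  UnitDisc.mem_meshDomain_ball

/-- Adjacency in `𝔻_δ`: `ℤ²`-adjacency of two sites of the open disc (`UnitDisc.adj_iff`).
[folklore] -/
theorem adj_discData_iff {δ : ℝ} {u v : Site 2} :
    (discreteDomainGraph (discData δ).Ω (discData δ).δ).Adj u v ↔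
      (zdGraph 2).Adj u v ∧ ‖meshPoint δ u‖ < 1 ∧ ‖meshPoint δ v‖ < 1 :=
  UnitDisc.adj_iff

/-- Boundary sites of the data lie in the open disc. [folklore] -/
theorem norm_lt_one_of_mem_zdBoundary {δ : ℝ} {x : Site 2} (hx : x ∈ (discData δ).zdBoundary) :
    ‖meshPoint δ x‖ < 1 :=
  mem_meshDomain_discData.1 ((discData δ).zdBoundary_subset_meshDomain hx)

/-- **Sites strictly above the line are in the discrete arc of `A` and not in that of `B`.**
[folklore] -/
theorem mem_zdArcA_of_pos {δ : ℝ} {x : Site 2} (hx : x ∈ (discData δ).zdBoundary)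
    (hpos : 0 < tilt δ (meshPoint δ x)) :
    x ∈ (discData δ).zdArcA ∧ x ∉ (discData δ).zdArcB := by
  have hin := norm_lt_one_of_mem_zdBoundary hx
  have hp0 : meshPoint δ x ≠ 0 := by rintro h; rw [h] at hpos; simp [tilt] at hpos
  obtain ⟨u, hu1, hdu, htu⟩ := exists_proj (δ := δ) hin hp0
  have hupos : 0 < tilt δ u := by rw [htu]; exact mul_pos (inv_pos.2 (norm_pos_iff.2 hp0)) hpos
  have hlt := one_sub_norm_lt_infDist_tiltLo hpos
  constructor
  · refine ⟨hx, ?_⟩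
    change infDist (meshPoint δ x) (tiltUp δ) ≤
      infDist (meshPoint δ x) (frontier (discData δ).Ω \ tiltUp δ)
    rw [frontier_discData_Ω]
    have hsub : sphere (0 : ℂ) 1 \ tiltUp δ ⊆ tiltLo δ := by
      intro w hw
      rw [Set.mem_sdiff, mem_sphere_iff_norm, sub_zero] at hw
      refine ⟨hw.1, ?_⟩
      by_contra h
      exact hw.2 ⟨hw.1, (not_le.1 h).le⟩
    have hne : (sphere (0 : ℂ) 1 \ tiltUp δ).Nonempty :=
      ⟨-Complex.I, by simp, fun h => by
        have := h.2; rw [tilt_neg, tilt_I] at this; norm_num at this⟩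
    calc infDist (meshPoint δ x) (tiltUp δ) ≤ 1 - ‖meshPoint δ x‖ := infDist_tiltUp_le hin hpos
      _ ≤ infDist (meshPoint δ x) (tiltLo δ) := hlt.le
      _ ≤ infDist (meshPoint δ x) (sphere 0 1 \ tiltUp δ) := infDist_le_infDist_of_subset hsub hne
  · rintro ⟨-, hB⟩
    change infDist (meshPoint δ x) (tiltLo δ) ≤
      infDist (meshPoint δ x) (frontier (discData δ).Ω \ tiltLo δ) at hB
    rw [frontier_discData_Ω] at hB
    have hmem : u ∈ sphere (0 : ℂ) 1 \ tiltLo δ :=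
      ⟨by rw [mem_sphere_iff_norm, sub_zero]; exact hu1, fun h => not_lt.2 h.2 hupos⟩
    have h1 : infDist (meshPoint δ x) (sphere (0 : ℂ) 1 \ tiltLo δ) ≤ 1 - ‖meshPoint δ x‖ :=
      (infDist_le_dist_of_mem hmem).trans hdu.le
    linarith

/-- **Sites strictly below the line are in the discrete arc of `B` and not in that of `A`.**
[folklore] -/
theorem mem_zdArcB_of_neg {δ : ℝ} {x : Site 2} (hx : x ∈ (discData δ).zdBoundary)
    (hneg : tilt δ (meshPoint δ x) < 0) :
    x ∈ (discData δ).zdArcB ∧ x ∉ (discData δ).zdArcA := by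
  have hin := norm_lt_one_of_mem_zdBoundary hx
  have hp0 : meshPoint δ x ≠ 0 := by rintro h; rw [h] at hneg; simp [tilt] at hneg
  obtain ⟨u, hu1, hdu, htu⟩ := exists_proj (δ := δ) hin hp0
  have huneg : tilt δ u < 0 := by
    rw [htu]; exact mul_neg_of_pos_of_neg (inv_pos.2 (norm_pos_iff.2 hp0)) hneg
  have hlt := one_sub_norm_lt_infDist_tiltUp hneg
  constructor
  · refine ⟨hx, ?_⟩
    change infDist (meshPoint δ x) (tiltLo δ) ≤
      infDist (meshPoint δ x) (frontier (discData δ).Ω \ tiltLo δ)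
    rw [frontier_discData_Ω]
    have hsub : sphere (0 : ℂ) 1 \ tiltLo δ ⊆ tiltUp δ := by
      intro w hw
      rw [Set.mem_sdiff, mem_sphere_iff_norm, sub_zero] at hw
      refine ⟨hw.1, ?_⟩
      by_contra h
      exact hw.2 ⟨hw.1, (not_le.1 h).le⟩
    have hne : (sphere (0 : ℂ) 1 \ tiltLo δ).Nonempty :=
      ⟨Complex.I, by simp, fun h => by
        have := h.2; rw [tilt_I] at this; norm_num at this⟩
    calc infDist (meshPoint δ x) (tiltLo δ) ≤ 1 - ‖meshPoint δ x‖ := infDist_tiltLo_le hin hneg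
      _ ≤ infDist (meshPoint δ x) (tiltUp δ) := hlt.le
      _ ≤ infDist (meshPoint δ x) (sphere 0 1 \ tiltLo δ) := infDist_le_infDist_of_subset hsub hne
  · rintro ⟨-, hA⟩
    change infDist (meshPoint δ x) (tiltUp δ) ≤
      infDist (meshPoint δ x) (frontier (discData δ).Ω \ tiltUp δ) at hA
    rw [frontier_discData_Ω] at hA
    have hmem : u ∈ sphere (0 : ℂ) 1 \ tiltUp δ :=
      ⟨by rw [mem_sphere_iff_norm, sub_zero]; exact hu1, fun h => not_lt.2 h.2 huneg⟩
    have h1 : infDist (meshPoint δ x) (sphere (0 : ℂ) 1 \ tiltUp δ) ≤ 1 - ‖meshPoint δ x‖ :=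
      (infDist_le_dist_of_mem hmem).trans hdu.le
    linarith

/-! ### Lattice bookkeeping: inside sites, corners, boundary sites -/

/-- The tilt functional at a mesh point. [folklore] -/
theorem tilt_meshPoint (δ : ℝ) (x : Site 2) :
    tilt δ (meshPoint δ x) = δ * ((x 1 : ℝ) - δ / 2 * (x 0 : ℝ)) := by
  rw [tilt, meshPoint_re, meshPoint_im]; ring

/-- For a site of the open disc, `|δ x₀| < 1`. [folklore] -/
theorem abs_mul_lt_one {δ : ℝ} {x : Site 2} (hin : ‖meshPoint δ x‖ < 1) : |δ * (x 0 : ℝ)| < 1 := by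
  rw [UnitDisc.norm_meshPoint_lt_one_iff] at hin
  have h : (δ * (x 0 : ℝ)) ^ 2 < 1 := by nlinarith [sq_nonneg (δ * (x 1 : ℝ))]
  exact (sq_lt_one_iff_abs_lt_one _).1 h

/-- **Sign of the tilt at the sites of the disc** (`0 < δ`): positive iff `x₁ ≥ 1` or
`x₁ = 0, x₀ < 0`; negative iff `x₁ ≤ -1` or `x₁ = 0, x₀ > 0`; zero only at the origin. [folklore] -/
theorem tilt_pos_iff {δ : ℝ} (hδ : 0 < δ) {x : Site 2} (hin : ‖meshPoint δ x‖ < 1) :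
    0 < tilt δ (meshPoint δ x) ↔ 1 ≤ x 1 ∨ (x 1 = 0 ∧ x 0 < 0) := by
  have hb := abs_lt.1 (abs_mul_lt_one hin)
  rw [tilt_meshPoint, mul_pos_iff_of_pos_left hδ, sub_pos]
  constructor
  · intro h
    rcases lt_trichotomy (x 1) 0 with h1 | h1 | h1
    · exfalso
      have : (x 1 : ℝ) ≤ -1 := by exact_mod_cast Int.le_sub_one_of_lt h1
      nlinarith
    · right
      refine ⟨h1, ?_⟩
      rw [h1, Int.cast_zero] at h
      have : δ * (x 0 : ℝ) < 0 := by nlinarith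
      have h' : (x 0 : ℝ) < 0 := neg_of_mul_neg_right this hδ.le
      exact_mod_cast h'
    · exact Or.inl (by omega)
  · rintro (h | ⟨h1, h0⟩)
    · have : (1 : ℝ) ≤ x 1 := by exact_mod_cast h
      nlinarith
    · rw [h1, Int.cast_zero]
      have : (x 0 : ℝ) ≤ -1 := by exact_mod_cast Int.le_sub_one_of_lt h0
      nlinarith

/-- Negative tilt at a site of the disc: `x₁ ≤ -1`, or `x₁ = 0` and `x₀ > 0` (`0 < δ`). [folklore] -/
theorem tilt_neg_iff {δ : ℝ} (hδ : 0 < δ) {x : Site 2} (hin : ‖meshPoint δ x‖ < 1) :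
    tilt δ (meshPoint δ x) < 0 ↔ x 1 ≤ -1 ∨ (x 1 = 0 ∧ 0 < x 0) := by
  have hb := abs_lt.1 (abs_mul_lt_one hin)
  rw [tilt_meshPoint]
  rw [show δ * ((x 1 : ℝ) - δ / 2 * (x 0 : ℝ)) < 0 ↔ (x 1 : ℝ) - δ / 2 * (x 0 : ℝ) < 0 from
    ⟨fun h => by nlinarith, fun h => mul_neg_of_pos_of_neg hδ h⟩, sub_neg]
  constructor
  · intro h
    rcases lt_trichotomy (x 1) 0 with h1 | h1 | h1
    · exact Or.inl (by omega)
    · right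
      refine ⟨h1, ?_⟩
      rw [h1, Int.cast_zero] at h
      have : 0 < δ * (x 0 : ℝ) := by nlinarith
      exact_mod_cast (pos_of_mul_pos_right this hδ.le : (0 : ℝ) < x 0)
    · exfalso
      have : (1 : ℝ) ≤ x 1 := by exact_mod_cast h1
      nlinarith
  · rintro (h | ⟨h1, h0⟩)
    · have : (x 1 : ℝ) ≤ -1 := by exact_mod_cast h
      nlinarith
    · rw [h1, Int.cast_zero]
      have : (1 : ℝ) ≤ x 0 := by exact_mod_cast h0
      nlinarith

/-- The tilt vanishes only at the origin (among the sites of the disc). [folklore] -/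
theorem eq_zero_of_tilt_eq_zero {δ : ℝ} (hδ : 0 < δ) {x : Site 2} (hin : ‖meshPoint δ x‖ < 1)
    (h0 : tilt δ (meshPoint δ x) = 0) : x = 0 := by
  have hb := abs_lt.1 (abs_mul_lt_one hin)
  have h1 : ¬ (1 ≤ x 1 ∨ (x 1 = 0 ∧ x 0 < 0)) := fun h => (lt_irrefl (0 : ℝ)) (by
    have := (tilt_pos_iff hδ hin).2 h; rwa [h0] at this)
  have h2 : ¬ (x 1 ≤ -1 ∨ (x 1 = 0 ∧ 0 < x 0)) := fun h => (lt_irrefl (0 : ℝ)) (by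
    have := (tilt_neg_iff hδ hin).2 h; rwa [h0] at this)
  funext i
  fin_cases i <;> simp <;> omega

/-- Adjacent sites of `ℤ²` differ by at most one in each coordinate. [folklore] -/
theorem abs_sub_le_one_of_adj {x y : Site 2} (h : (zdGraph 2).Adj x y) (i : Fin 2) :
    |y i - x i| ≤ 1 := by
  obtain ⟨j, hj | hj⟩ := (zdGraph_adj_iff x y).1 h
  · rw [hj, Pi.add_apply]
    by_cases hij : i = j
    · subst hij; simp
    · rw [Pi.single_eq_of_ne hij]; simp
  · rw [hj, Pi.add_apply]
    by_cases hij : i = j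
    · subst hij; simp
    · rw [Pi.single_eq_of_ne hij]; simp

/-- Two corners of a face differ by at most one in each coordinate. [folklore] -/
theorem abs_sub_le_one_of_isCorner {v w f : Site 2} (hv : IsCorner v f) (hw : IsCorner w f)
    (i : Fin 2) : |v i - w i| ≤ 1 := by
  rcases hv i with h | h <;> rcases hw i with h' | h' <;> rw [h, h', abs_le] <;> constructor <;> linarith

/-- **A boundary site of the data has an outside site at `ℓ∞`-distance `≤ 1`** (a neighbour, for a
site of `meshBoundary`; a corner of the non-inner face, for an endpoint of a face-boundary edge).
[folklore] -/
theorem exists_outside_of_mem_zdBoundary {δ : ℝ} {x : Site 2} (hx : x ∈ (discData δ).zdBoundary) :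
    ∃ y : Site 2, ¬ ‖meshPoint δ y‖ < 1 ∧ |y 0 - x 0| ≤ 1 ∧ |y 1 - x 1| ≤ 1 := by
  rcases hx with ⟨hxD, y, hxy, hn⟩ | ⟨y, -, -, f, hf, hxf, -⟩
  · refine ⟨y, fun hy => hn (adj_discData_iff.2 ⟨hxy, mem_meshDomain_discData.1 hxD, hy⟩),
      abs_sub_le_one_of_adj hxy 0, abs_sub_le_one_of_adj hxy 1⟩
  · -- some side of the non-inner face `f` is not an edge of `𝔻_δ`: one of its ends is outside
    simp only [DiscreteDobrushin.IsInnerFace, not_forall] at hf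
    obtain ⟨v, w, hv, hw, hvw, hn⟩ := hf
    rw [adj_discData_iff, not_and, not_and_or] at hn
    rcases hn hvw with h | h
    · exact ⟨v, h, abs_sub_le_one_of_isCorner hv hxf 0, abs_sub_le_one_of_isCorner hv hxf 1⟩
    · exact ⟨w, h, abs_sub_le_one_of_isCorner hw hxf 0, abs_sub_le_one_of_isCorner hw hxf 1⟩

/-- Quantitative form: a boundary site `x` satisfies `1 ≤ δ² ((|x₀|+1)² + (|x₁|+1)²)`. [folklore] -/
theorem one_le_of_mem_zdBoundary {δ : ℝ} {x : Site 2} (hx : x ∈ (discData δ).zdBoundary) :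
    1 ≤ δ ^ 2 * ((|(x 0 : ℝ)| + 1) ^ 2 + (|(x 1 : ℝ)| + 1) ^ 2) := by
  obtain ⟨y, hy, h0, h1⟩ := exists_outside_of_mem_zdBoundary hx
  rw [UnitDisc.norm_meshPoint_lt_one_iff, not_lt] at hy
  have h0' : |(y 0 : ℝ)| ≤ |(x 0 : ℝ)| + 1 := by
    have : (|y 0 - x 0| : ℝ) ≤ 1 := by exact_mod_cast h0
    rw [← Int.cast_sub] at this
    push_cast at this
    linarith [abs_sub_abs_le_abs_sub (y 0 : ℝ) (x 0 : ℝ)]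
  have h1' : |(y 1 : ℝ)| ≤ |(x 1 : ℝ)| + 1 := by
    have : (|y 1 - x 1| : ℝ) ≤ 1 := by exact_mod_cast h1
    rw [← Int.cast_sub] at this
    push_cast at this
    linarith [abs_sub_abs_le_abs_sub (y 1 : ℝ) (x 1 : ℝ)]
  have e0 : ((y 0 : ℤ) : ℝ) ^ 2 ≤ (|(x 0 : ℝ)| + 1) ^ 2 := by
    rw [← sq_abs]; exact pow_le_pow_left₀ (abs_nonneg _) h0' 2
  have e1 : ((y 1 : ℤ) : ℝ) ^ 2 ≤ (|(x 1 : ℝ)| + 1) ^ 2 := by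
    rw [← sq_abs]; exact pow_le_pow_left₀ (abs_nonneg _) h1' 2
  nlinarith [sq_nonneg δ]

/-- The origin is not a boundary site for `δ² < 1/2`. [folklore] -/
theorem zero_not_mem_zdBoundary {δ : ℝ} (hδ : δ ^ 2 < 1 / 2) : (0 : Site 2) ∉ (discData δ).zdBoundary :=
  fun h => by
    have := one_le_of_mem_zdBoundary h
    simp at this
    linarith

/-- Hence the tilt of a boundary site is nonzero (`0 < δ`, `δ² < 1/2`). [folklore] -/
theorem tilt_ne_zero_of_mem_zdBoundary {δ : ℝ} (hδ : 0 < δ) (hδ' : δ ^ 2 < 1 / 2) {x : Site 2}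
    (hx : x ∈ (discData δ).zdBoundary) : tilt δ (meshPoint δ x) ≠ 0 := fun h0 =>
  zero_not_mem_zdBoundary hδ' (eq_zero_of_tilt_eq_zero hδ (norm_lt_one_of_mem_zdBoundary hx) h0 ▸ hx)

/-- A site of the discrete arc of `A` has positive tilt (`0 < δ`, `δ² < 1/2`). [folklore] -/
theorem tilt_pos_of_mem_zdArcA {δ : ℝ} (hδ : 0 < δ) (hδ' : δ ^ 2 < 1 / 2) {x : Site 2}
    (hx : x ∈ (discData δ).zdArcA) : 0 < tilt δ (meshPoint δ x) := by
  have hxb : x ∈ (discData δ).zdBoundary := (discData δ).zdArcA_subset_zdBoundary hx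
  rcases lt_trichotomy (tilt δ (meshPoint δ x)) 0 with h | h | h
  · exact absurd hx (mem_zdArcB_of_neg hxb h).2
  · exact absurd h (tilt_ne_zero_of_mem_zdBoundary hδ hδ' hxb)
  · exact h

/-- A site of the discrete arc of `B` has negative tilt (`0 < δ`, `δ² < 1/2`). [folklore] -/
theorem tilt_neg_of_mem_zdArcB {δ : ℝ} (hδ : 0 < δ) (hδ' : δ ^ 2 < 1 / 2) {x : Site 2}
    (hx : x ∈ (discData δ).zdArcB) : tilt δ (meshPoint δ x) < 0 := by
  have hxb : x ∈ (discData δ).zdBoundary := (discData δ).zdArcB_subset_zdBoundary hx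
  rcases lt_trichotomy (tilt δ (meshPoint δ x)) 0 with h | h | h
  · exact h
  · exact absurd h (tilt_ne_zero_of_mem_zdBoundary hδ hδ' hxb)
  · exact absurd hx (mem_zdArcA_of_pos hxb h).2


/-! ### The column of the `A`–`B` edges -/

/-- The column `M = abCol δ` of the two `A`–`B` edges: the largest natural number with
`δ² (M² + 1) < 1`, i.e. `⌈√(δ⁻² - 1)⌉ - 1`. [folklore] -/
def abCol (δ : ℝ) : ℕ := ⌈Real.sqrt (δ⁻¹ ^ 2 - 1)⌉₊ - 1

section Col

variable {δ : ℝ} (hδ : 0 < δ) (hδ' : δ < 1 / 2)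
include hδ hδ'

/-- `δ⁻² - 1 > 1` for `0 < δ < 1/2`. [folklore] -/
theorem one_lt_inv_sq_sub_one : 1 < δ⁻¹ ^ 2 - 1 := by
  have h2 : 2 < δ⁻¹ := by
    rw [lt_inv_comm₀ (by norm_num) hδ]; linarith
  nlinarith

/-- `M + 1 = ⌈√(δ⁻² - 1)⌉`. [folklore] -/
theorem abCol_add_one : ((abCol δ : ℕ) : ℝ) + 1 = ⌈Real.sqrt (δ⁻¹ ^ 2 - 1)⌉₊ := by
  have hpos : 0 < Real.sqrt (δ⁻¹ ^ 2 - 1) :=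
    Real.sqrt_pos.2 (by linarith [one_lt_inv_sq_sub_one hδ hδ'])
  have h1 : 1 ≤ ⌈Real.sqrt (δ⁻¹ ^ 2 - 1)⌉₊ := Nat.one_le_ceil_iff.2 hpos
  rw [abCol]
  exact_mod_cast Nat.sub_add_cancel h1

/-- `δ² (M² + 1) < 1`: the sites `(±M, 0)`, `(±M, ±1)` lie in the open disc. [folklore] -/
theorem sq_abCol_lt : δ ^ 2 * (((abCol δ : ℕ) : ℝ) ^ 2 + 1) < 1 := by
  set s := Real.sqrt (δ⁻¹ ^ 2 - 1) with hs
  have hs2 : s ^ 2 = δ⁻¹ ^ 2 - 1 := Real.sq_sqrt (by linarith [one_lt_inv_sq_sub_one hδ hδ'])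
  have hlt : ((abCol δ : ℕ) : ℝ) < s := by
    have h := abCol_add_one hδ hδ'
    have : abCol δ < ⌈s⌉₊ := by
      have h' : (abCol δ : ℝ) + 1 = (⌈s⌉₊ : ℝ) := h
      exact_mod_cast (by linarith : (abCol δ : ℝ) < ⌈s⌉₊)
    exact Nat.lt_ceil.1 this
  have h0 : (0 : ℝ) ≤ abCol δ := Nat.cast_nonneg _
  have hsq : ((abCol δ : ℕ) : ℝ) ^ 2 < δ⁻¹ ^ 2 - 1 := by
    rw [← hs2]; exact pow_lt_pow_left₀ hlt h0 two_ne_zero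
  have hδ2 : 0 < δ ^ 2 := by positivity
  have key : δ ^ 2 * (((abCol δ : ℕ) : ℝ) ^ 2 + 1) < δ ^ 2 * δ⁻¹ ^ 2 :=
    mul_lt_mul_of_pos_left (by linarith) hδ2
  rwa [← mul_pow, mul_inv_cancel₀ hδ.ne', one_pow] at key

/-- `1 ≤ δ² ((M+1)² + 1)`: the sites `(±(M+1), ±1)` lie outside the open disc. [folklore] -/
theorem one_le_sq_abCol_succ : 1 ≤ δ ^ 2 * ((((abCol δ : ℕ) : ℝ) + 1) ^ 2 + 1) := by
  set s := Real.sqrt (δ⁻¹ ^ 2 - 1) with hs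
  have hs2 : s ^ 2 = δ⁻¹ ^ 2 - 1 := Real.sq_sqrt (by linarith [one_lt_inv_sq_sub_one hδ hδ'])
  have hle : s ≤ ((abCol δ : ℕ) : ℝ) + 1 := by
    rw [abCol_add_one hδ hδ']; exact Nat.le_ceil _
  have hsq : δ⁻¹ ^ 2 - 1 ≤ (((abCol δ : ℕ) : ℝ) + 1) ^ 2 := by
    rw [← hs2]; exact pow_le_pow_left₀ (Real.sqrt_nonneg _) hle 2
  have hδ2 : 0 ≤ δ ^ 2 := by positivity
  have key : δ ^ 2 * δ⁻¹ ^ 2 ≤ δ ^ 2 * ((((abCol δ : ℕ) : ℝ) + 1) ^ 2 + 1) :=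
    mul_le_mul_of_nonneg_left (by linarith) hδ2
  rwa [← mul_pow, mul_inv_cancel₀ hδ.ne', one_pow] at key

/-- `1 ≤ M` for `δ < 1/2`. [folklore] -/
theorem one_le_abCol : 1 ≤ abCol δ := by
  by_contra h
  have h0 : abCol δ = 0 := by omega
  have := one_le_sq_abCol_succ hδ hδ'
  rw [h0, Nat.cast_zero] at this
  nlinarith

/-- Maximality of `M`: `δ² (n² + 1) < 1` forces `n ≤ M`. [folklore] -/
theorem le_abCol_of_lt {n : ℕ} (h : δ ^ 2 * ((n : ℝ) ^ 2 + 1) < 1) : n ≤ abCol δ := by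
  by_contra hn
  have hle : ((abCol δ : ℕ) : ℝ) + 1 ≤ n := by exact_mod_cast Nat.succ_le_of_lt (not_le.1 hn)
  have h1 := one_le_sq_abCol_succ hδ hδ'
  have h0 : (0 : ℝ) ≤ (abCol δ : ℝ) + 1 := by positivity
  have : (((abCol δ : ℕ) : ℝ) + 1) ^ 2 ≤ (n : ℝ) ^ 2 := pow_le_pow_left₀ h0 hle 2
  nlinarith [sq_nonneg δ]

/-- Minimality: `1 ≤ δ² ((n+1)² + 1)` forces `M ≤ n`. [folklore] -/
theorem abCol_le_of_le {n : ℕ} (h : 1 ≤ δ ^ 2 * (((n : ℝ) + 1) ^ 2 + 1)) : abCol δ ≤ n := by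
  by_contra hn
  have hle : (n : ℝ) + 1 ≤ abCol δ := by exact_mod_cast Nat.succ_le_of_lt (not_le.1 hn)
  have h1 := sq_abCol_lt hδ hδ'
  have h0 : (0 : ℝ) ≤ (n : ℝ) + 1 := by positivity
  have : ((n : ℝ) + 1) ^ 2 ≤ ((abCol δ : ℕ) : ℝ) ^ 2 := pow_le_pow_left₀ h0 hle 2
  nlinarith [sq_nonneg δ]

end Col

/-! ### The two `A`–`B` edges -/

/-- The right `A`–`B` edge `{(M, 1), (M, 0)}`. [folklore] -/
def eR (δ : ℝ) : Sym2 (Site 2) := s(![(abCol δ : ℤ), 1], ![(abCol δ : ℤ), 0])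

/-- The left `A`–`B` edge `{(-M, 0), (-M, -1)}`. [folklore] -/
def eL (δ : ℝ) : Sym2 (Site 2) := s(![-(abCol δ : ℤ), 0], ![-(abCol δ : ℤ), -1])

/-- The two `A`–`B` edges are distinct. [folklore] -/
theorem eR_ne_eL (δ : ℝ) : eR δ ≠ eL δ := by
  intro h
  have hmem : (![(abCol δ : ℤ), 1] : Site 2) ∈ eL δ := by rw [← h, eR]; exact Sym2.mem_mk_left _ _
  rw [eL, Sym2.mem_iff] at hmem
  rcases hmem with h1 | h1 <;> have := congr_fun h1 1 <;> simp at this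

/-- Adjacency in `ℤ²` in coordinates (local copy of `OnsagerYang.zdGraph_two_adj_iff_coord`).
[folklore] -/
theorem adj_coord {x y : Site 2} (h : (zdGraph 2).Adj x y) :
    ((y 0 = x 0 + 1 ∨ x 0 = y 0 + 1) ∧ y 1 = x 1) ∨ ((y 1 = x 1 + 1 ∨ x 1 = y 1 + 1) ∧ y 0 = x 0) := by
  rw [zdGraph_adj_iff, Fin.exists_fin_two] at h
  simp only [funext_iff, Fin.forall_fin_two, Pi.add_apply, Pi.single_eq_same,
    Pi.single_eq_of_ne (one_ne_zero : (1 : Fin 2) ≠ 0),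
    Pi.single_eq_of_ne (zero_ne_one : (0 : Fin 2) ≠ 1), add_zero] at h
  omega

/-- `x` and `x + e₁` are adjacent in `ℤ²` (coordinate form). [folklore] -/
theorem adj_of_eq_add_single_one {x y : Site 2} (h : ∀ i, y i = x i + (Pi.single 1 1 : Site 2) i) :
    (zdGraph 2).Adj x y :=
  (zdGraph_adj_iff x y).2 ⟨1, Or.inl (funext fun i => by rw [Pi.add_apply, h i])⟩

/-- **Shape of an `A`–`B` edge.** Two `ℤ²`-adjacent sites of the disc with tilts of opposite
strict signs form a vertical edge `{(i, 1), (i, 0)}` with `i > 0` or `{(i, 0), (i, -1)}` with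
`i < 0` (`0 < δ`). [folklore] -/
theorem adj_pos_neg {δ : ℝ} (hδ : 0 < δ) {x y : Site 2} (hxy : (zdGraph 2).Adj x y)
    (hx : ‖meshPoint δ x‖ < 1) (hy : ‖meshPoint δ y‖ < 1) (hpos : 0 < tilt δ (meshPoint δ x))
    (hneg : tilt δ (meshPoint δ y) < 0) :
    (x 1 = 1 ∧ y 1 = 0 ∧ y 0 = x 0 ∧ 0 < x 0) ∨ (x 1 = 0 ∧ y 1 = -1 ∧ y 0 = x 0 ∧ x 0 < 0) := by
  rw [tilt_pos_iff hδ hx] at hpos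
  rw [tilt_neg_iff hδ hy] at hneg
  have h := adj_coord hxy
  omega

/-- A face all of whose corners lie in the disc is inner. [folklore] -/
theorem isInnerFace_of_forall {δ : ℝ} {f : Site 2} (h : ∀ v, IsCorner v f → ‖meshPoint δ v‖ < 1) :
    (discData δ).IsInnerFace f := fun v w hv hw hvw =>
  adj_discData_iff.2 ⟨hvw, h v hv, h w hw⟩

/-- A face with two adjacent corners one of which is outside the disc is not inner. [folklore] -/
theorem not_isInnerFace_of {δ : ℝ} {f v w : Site 2} (hv : IsCorner v f) (hw : IsCorner w f)
    (hvw : (zdGraph 2).Adj v w) (hout : ¬ ‖meshPoint δ w‖ < 1) : ¬ (discData δ).IsInnerFace f :=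
  fun hf => hout (adj_discData_iff.1 (hf v w hv hw hvw)).2.2

section Edges

variable {δ : ℝ} (hδ : 0 < δ) (hδ' : δ < 1 / 2)
include hδ hδ'

/-- `δ² < 1/2` for `0 < δ < 1/2`. [folklore] -/
theorem sq_lt_half : δ ^ 2 < 1 / 2 := by nlinarith

/-- A site with `|x₀| ≤ M`, `|x₁| ≤ 1` lies in the open disc. [folklore] -/
theorem norm_lt_one_of_abs_le {x : Site 2} (h0 : |x 0| ≤ (abCol δ : ℤ)) (h1 : |x 1| ≤ 1) :
    ‖meshPoint δ x‖ < 1 := by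
  rw [UnitDisc.norm_meshPoint_lt_one_iff]
  have h0' : |((x 0 : ℤ) : ℝ)| ≤ (abCol δ : ℝ) := by
    rw [← Int.cast_abs]; exact_mod_cast h0
  have h1' : |((x 1 : ℤ) : ℝ)| ≤ 1 := by
    rw [← Int.cast_abs]; exact_mod_cast h1
  have e0 : ((x 0 : ℤ) : ℝ) ^ 2 ≤ (abCol δ : ℝ) ^ 2 := by
    rw [← sq_abs]; exact pow_le_pow_left₀ (abs_nonneg _) h0' 2
  have e1 : ((x 1 : ℤ) : ℝ) ^ 2 ≤ 1 := by
    rw [← sq_abs]; nlinarith [abs_nonneg ((x 1 : ℤ) : ℝ)]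
  have := sq_abCol_lt hδ hδ'
  nlinarith [sq_nonneg δ]

/-- The site `(±(M+1), x₁)` with `|x₁| ≥ 1` lies outside the open disc. [folklore] -/
theorem not_norm_lt_one_of {x : Site 2} (h0 : |x 0| = (abCol δ : ℤ) + 1) (h1 : 1 ≤ |x 1|) :
    ¬ ‖meshPoint δ x‖ < 1 := by
  rw [UnitDisc.norm_meshPoint_lt_one_iff, not_lt]
  have h0' : |((x 0 : ℤ) : ℝ)| = (abCol δ : ℝ) + 1 := by
    rw [← Int.cast_abs]; exact_mod_cast h0
  have h1' : 1 ≤ |((x 1 : ℤ) : ℝ)| := by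
    rw [← Int.cast_abs]; exact_mod_cast h1
  have e0 : ((x 0 : ℤ) : ℝ) ^ 2 = ((abCol δ : ℝ) + 1) ^ 2 := by rw [← sq_abs, h0']
  have e1 : 1 ≤ ((x 1 : ℤ) : ℝ) ^ 2 := by
    rw [← sq_abs]; nlinarith
  have := one_le_sq_abCol_succ hδ hδ'
  nlinarith [sq_nonneg δ]

/-- The face `(M-1, 0)` (left of the right `A`–`B` edge) is inner. [folklore] -/
theorem isInnerFace_fR : (discData δ).IsInnerFace ![(abCol δ : ℤ) - 1, 0] := by
  have hM : (1 : ℤ) ≤ abCol δ := by exact_mod_cast one_le_abCol hδ hδ'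
  refine isInnerFace_of_forall fun v hv => norm_lt_one_of_abs_le hδ hδ' ?_ ?_
  · rcases hv 0 with h | h <;> simp at h <;> rw [h, abs_le] <;> constructor <;> linarith
  · rcases hv 1 with h | h <;> simp at h <;> rw [h] <;> simp

/-- The face `(M, 0)` (right of the right `A`–`B` edge) is not inner: its corner `(M+1, 1)` is
outside. [folklore] -/
theorem not_isInnerFace_gR : ¬ (discData δ).IsInnerFace ![(abCol δ : ℤ), 0] := by
  refine not_isInnerFace_of (v := ![(abCol δ : ℤ) + 1, 0]) (w := ![(abCol δ : ℤ) + 1, 1])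
    ?_ ?_ ?_ ?_
  · intro i; fin_cases i <;> simp
  · intro i; fin_cases i <;> simp
  · exact adj_of_eq_add_single_one fun i => by fin_cases i <;> simp
  · refine not_norm_lt_one_of hδ hδ' ?_ ?_
    · have : (0 : ℤ) ≤ abCol δ := Int.natCast_nonneg _
      simp only [Matrix.cons_val_zero]
      rw [abs_of_nonneg (by linarith)]
    · simp

/-- The face `(-M, -1)` (right of the left `A`–`B` edge) is inner. [folklore] -/
theorem isInnerFace_fL : (discData δ).IsInnerFace ![-(abCol δ : ℤ), -1] := by
  have hM : (1 : ℤ) ≤ abCol δ := by exact_mod_cast one_le_abCol hδ hδ'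
  refine isInnerFace_of_forall fun v hv => norm_lt_one_of_abs_le hδ hδ' ?_ ?_
  · rcases hv 0 with h | h <;> simp at h <;> rw [h, abs_le] <;> constructor <;> linarith
  · rcases hv 1 with h | h <;> simp at h <;> rw [h] <;> simp

/-- The face `(-M-1, -1)` (left of the left `A`–`B` edge) is not inner: its corner `(-M-1, -1)`
is outside. [folklore] -/
theorem not_isInnerFace_gL : ¬ (discData δ).IsInnerFace ![-(abCol δ : ℤ) - 1, -1] := by
  refine not_isInnerFace_of (v := ![-(abCol δ : ℤ) - 1, 0]) (w := ![-(abCol δ : ℤ) - 1, -1])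
    ?_ ?_ ?_ ?_
  · intro i; fin_cases i <;> simp
  · intro i; fin_cases i <;> simp
  · exact (adj_of_eq_add_single_one fun i => by fin_cases i <;> simp).symm
  · refine not_norm_lt_one_of hδ hδ' ?_ ?_
    · have : (0 : ℤ) ≤ abCol δ := Int.natCast_nonneg _
      simp only [Matrix.cons_val_zero]
      rw [abs_of_nonpos (by linarith)]; ring
    · simp

/-- The right `A`–`B` edge is a face-boundary edge. [folklore] -/
theorem isFaceBoundaryEdge_R :
    (discData δ).IsFaceBoundaryEdge ![(abCol δ : ℤ), 0] ![(abCol δ : ℤ), 1] := by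
  have hM : (0 : ℤ) ≤ abCol δ := Int.natCast_nonneg _
  refine ⟨adj_discData_iff.2 ⟨?_, ?_, ?_⟩, ⟨_, isInnerFace_fR hδ hδ', ?_, ?_⟩,
    ⟨_, not_isInnerFace_gR hδ hδ', ?_, ?_⟩⟩
  · exact adj_of_eq_add_single_one fun i => by fin_cases i <;> simp
  · exact norm_lt_one_of_abs_le hδ hδ' (by simp [abs_of_nonneg hM]) (by simp)
  · exact norm_lt_one_of_abs_le hδ hδ' (by simp [abs_of_nonneg hM]) (by simp)
  · intro i; fin_cases i <;> simp
  · intro i; fin_cases i <;> simp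
  · intro i; fin_cases i <;> simp
  · intro i; fin_cases i <;> simp

/-- The left `A`–`B` edge is a face-boundary edge. [folklore] -/
theorem isFaceBoundaryEdge_L :
    (discData δ).IsFaceBoundaryEdge ![-(abCol δ : ℤ), -1] ![-(abCol δ : ℤ), 0] := by
  have hM : (0 : ℤ) ≤ abCol δ := Int.natCast_nonneg _
  refine ⟨adj_discData_iff.2 ⟨?_, ?_, ?_⟩, ⟨_, isInnerFace_fL hδ hδ', ?_, ?_⟩,
    ⟨_, not_isInnerFace_gL hδ hδ', ?_, ?_⟩⟩
  · exact adj_of_eq_add_single_one fun i => by fin_cases i <;> simp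
  · exact norm_lt_one_of_abs_le hδ hδ' (by simp [abs_of_nonneg hM]) (by simp)
  · exact norm_lt_one_of_abs_le hδ hδ' (by simp [abs_of_nonneg hM]) (by simp)
  · intro i; fin_cases i <;> simp
  · intro i; fin_cases i <;> simp
  · intro i; fin_cases i <;> simp
  · intro i; fin_cases i <;> simp

/-- `(M, 1)` is in the discrete arc of `A`. [folklore] -/
theorem xR1_mem_zdArcA : (![(abCol δ : ℤ), 1] : Site 2) ∈ (discData δ).zdArcA := by
  have hb := (isFaceBoundaryEdge_R hδ hδ').mem_zdBoundary.2
  refine (mem_zdArcA_of_pos hb ((tilt_pos_iff hδ (norm_lt_one_of_mem_zdBoundary hb)).2 ?_)).1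
  simp

/-- `(M, 0)` is in the discrete arc of `B`. [folklore] -/
theorem xR0_mem_zdArcB : (![(abCol δ : ℤ), 0] : Site 2) ∈ (discData δ).zdArcB := by
  have hb := (isFaceBoundaryEdge_R hδ hδ').mem_zdBoundary.1
  refine (mem_zdArcB_of_neg hb ((tilt_neg_iff hδ (norm_lt_one_of_mem_zdBoundary hb)).2 ?_)).1
  have := one_le_abCol hδ hδ'
  simp; omega

/-- `(-M, 0)` is in the discrete arc of `A`. [folklore] -/
theorem xL0_mem_zdArcA : (![-(abCol δ : ℤ), 0] : Site 2) ∈ (discData δ).zdArcA := by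
  have hb := (isFaceBoundaryEdge_L hδ hδ').mem_zdBoundary.2
  refine (mem_zdArcA_of_pos hb ((tilt_pos_iff hδ (norm_lt_one_of_mem_zdBoundary hb)).2 ?_)).1
  have := one_le_abCol hδ hδ'
  simp; omega

/-- `(-M, -1)` is in the discrete arc of `B`. [folklore] -/
theorem xL1_mem_zdArcB : (![-(abCol δ : ℤ), -1] : Site 2) ∈ (discData δ).zdArcB := by
  have hb := (isFaceBoundaryEdge_L hδ hδ').mem_zdBoundary.1
  refine (mem_zdArcB_of_neg hb ((tilt_neg_iff hδ (norm_lt_one_of_mem_zdBoundary hb)).2 ?_)).1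
  simp

/-- `eR` is an `A`–`B` edge of the data. [folklore] -/
theorem eR_mem_zdABEdges : eR δ ∈ (discData δ).zdABEdges := by
  refine ⟨?_, ⟨_, Sym2.mem_mk_left _ _, xR1_mem_zdArcA hδ hδ'⟩,
    ⟨_, Sym2.mem_mk_right _ _, xR0_mem_zdArcB hδ hδ'⟩⟩
  rw [eR, SimpleGraph.mem_edgeSet]
  exact (isFaceBoundaryEdge_R hδ hδ').1.symm

/-- `eL` is an `A`–`B` edge of the data. [folklore] -/
theorem eL_mem_zdABEdges : eL δ ∈ (discData δ).zdABEdges := by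
  refine ⟨?_, ⟨_, Sym2.mem_mk_left _ _, xL0_mem_zdArcA hδ hδ'⟩,
    ⟨_, Sym2.mem_mk_right _ _, xL1_mem_zdArcB hδ hδ'⟩⟩
  rw [eL, SimpleGraph.mem_edgeSet]
  exact (isFaceBoundaryEdge_L hδ hδ').1.symm

/-- **Pinning an `A`–`B` edge.** An edge of `𝔻_δ` from a site of the arc of `A` to a site of the
arc of `B` is one of `eR`, `eL`. [folklore] -/
theorem mk_eq_of_mem {x y : Site 2} (hadj : (discreteDomainGraph (discData δ).Ω (discData δ).δ).Adj x y)
    (hxA : x ∈ (discData δ).zdArcA) (hyB : y ∈ (discData δ).zdArcB) :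
    s(x, y) = eR δ ∨ s(x, y) = eL δ := by
  have h2 := sq_lt_half hδ hδ'
  obtain ⟨hxy, hx, hy⟩ := adj_discData_iff.1 hadj
  have hpos := tilt_pos_of_mem_zdArcA hδ h2 hxA
  have hneg := tilt_neg_of_mem_zdArcB hδ h2 hyB
  have hxb := one_le_of_mem_zdBoundary ((discData δ).zdArcA_subset_zdBoundary hxA)
  have hyb := one_le_of_mem_zdBoundary ((discData δ).zdArcB_subset_zdBoundary hyB)
  rw [UnitDisc.norm_meshPoint_lt_one_iff] at hx hy
  rcases adj_pos_neg hδ hxy (UnitDisc.norm_meshPoint_lt_one_iff.2 hx) (UnitDisc.norm_meshPoint_lt_one_iff.2 hy) hpos hneg with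
    ⟨hx1, hy1, hy0, hx0⟩ | ⟨hx1, hy1, hy0, hx0⟩
  · -- right edge: `x = (i, 1)`, `y = (i, 0)`, `i > 0`; pin `i = M`
    left
    obtain ⟨n, hn⟩ : ∃ n : ℕ, x 0 = n := ⟨(x 0).toNat, (Int.toNat_of_nonneg hx0.le).symm⟩
    have hxn : ((x 0 : ℤ) : ℝ) = n := by rw [hn]; rfl
    have hle : n ≤ abCol δ := by
      refine le_abCol_of_lt hδ hδ' ?_
      rw [hxn, hx1] at hx; simpa using hx
    have hge : abCol δ ≤ n := by
      refine abCol_le_of_le hδ hδ' ?_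
      rw [hy0, hy1, hxn] at hyb
      simpa [abs_of_nonneg (Nat.cast_nonneg n : (0 : ℝ) ≤ n)] using hyb
    have hnM : (n : ℤ) = abCol δ := by exact_mod_cast le_antisymm hle hge
    rw [eR]
    congr 1 <;> funext i <;> fin_cases i <;> simp <;> omega
  · -- left edge: `x = (i, 0)`, `y = (i, -1)`, `i < 0`; pin `i = -M`
    right
    obtain ⟨n, hn⟩ : ∃ n : ℕ, x 0 = -n := ⟨(-(x 0)).toNat, by
      rw [Int.toNat_of_nonneg (by omega)]; ring⟩
    have hxn : ((x 0 : ℤ) : ℝ) = -n := by rw [hn]; push_cast; ring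
    have hle : n ≤ abCol δ := by
      refine le_abCol_of_lt hδ hδ' ?_
      rw [hy0, hy1, hxn] at hy; simpa using hy
    have hge : abCol δ ≤ n := by
      refine abCol_le_of_le hδ hδ' ?_
      rw [hx1, hxn] at hxb
      simpa [abs_of_nonneg (Nat.cast_nonneg n : (0 : ℝ) ≤ n)] using hxb
    have hnM : (n : ℤ) = abCol δ := by exact_mod_cast le_antisymm hle hge
    rw [eL]
    congr 1 <;> funext i <;> fin_cases i <;> simp <;> omega

/-- **The `A`–`B` edges of the tilted data are exactly `eR` and `eL`.** [folklore] -/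
theorem zdABEdges_discData : (discData δ).zdABEdges = {eR δ, eL δ} := by
  ext e
  constructor
  · intro he
    induction e using Sym2.ind with
    | h u v =>
      obtain ⟨he, ⟨x, hxe, hxA⟩, ⟨y, hye, hyB⟩⟩ := he
      rw [SimpleGraph.mem_edgeSet] at he
      have h2 := sq_lt_half hδ hδ'
      have hpos := tilt_pos_of_mem_zdArcA hδ h2 hxA
      have hneg := tilt_neg_of_mem_zdArcB hδ h2 hyB
      have hxy : x ≠ y := fun h => by rw [h] at hpos; exact lt_asymm hpos hneg
      rw [Sym2.mem_iff] at hxe hye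
      have key : s(u, v) = eR δ ∨ s(u, v) = eL δ := by
        rcases hxe with rfl | rfl <;> rcases hye with rfl | rfl
        · exact absurd rfl hxy
        · exact mk_eq_of_mem hδ hδ' he hxA hyB
        · rw [Sym2.eq_swap]; exact mk_eq_of_mem hδ hδ' he.symm hxA hyB
        · exact absurd rfl hxy
      rcases key with h | h <;> simp [h]
  · rintro (rfl | rfl)
    · exact eR_mem_zdABEdges hδ hδ'
    · exact eL_mem_zdABEdges hδ hδ'

end Edges


/-! ### Admissibility -/

section Admissible

variable {δ : ℝ} (hδ : 0 < δ) (hδ' : δ < 1 / 2)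
include hδ hδ'

/-- The corners of the right `A`–`B` edge are corners of exactly one inner face, `(M-1, 0)`.
[folklore] -/
theorem existsUnique_inner_eR :
    ∃! f, (discData δ).IsInnerFace f ∧ ∀ x ∈ eR δ, IsCorner x f := by
  refine ⟨![(abCol δ : ℤ) - 1, 0], ⟨isInnerFace_fR hδ hδ', fun x hx => ?_⟩, fun f' hf' => ?_⟩
  · rw [eR, Sym2.mem_iff] at hx
    rcases hx with rfl | rfl <;> intro i <;> fin_cases i <;> simp
  · obtain ⟨hf', hc⟩ := hf'
    have h1 := hc _ (by rw [eR]; exact Sym2.mem_mk_left _ _)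
    have h0 := hc _ (by rw [eR]; exact Sym2.mem_mk_right _ _)
    have h10 := h1 0; have h11 := h1 1; have h00 := h0 0; have h01 := h0 1
    simp at h10 h11 h00 h01
    have hf1 : f' 1 = 0 := by omega
    by_cases hf0 : f' 0 = abCol δ
    · exfalso
      have : f' = ![(abCol δ : ℤ), 0] := by funext i; fin_cases i <;> simp [hf0, hf1]
      exact not_isInnerFace_gR hδ hδ' (this ▸ hf')
    · funext i; fin_cases i <;> simp <;> omega

/-- The corners of the left `A`–`B` edge are corners of exactly one inner face, `(-M, -1)`.
[folklore] -/
theorem existsUnique_inner_eL :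
    ∃! f, (discData δ).IsInnerFace f ∧ ∀ x ∈ eL δ, IsCorner x f := by
  refine ⟨![-(abCol δ : ℤ), -1], ⟨isInnerFace_fL hδ hδ', fun x hx => ?_⟩, fun f' hf' => ?_⟩
  · rw [eL, Sym2.mem_iff] at hx
    rcases hx with rfl | rfl <;> intro i <;> fin_cases i <;> simp
  · obtain ⟨hf', hc⟩ := hf'
    have h1 := hc _ (by rw [eL]; exact Sym2.mem_mk_left _ _)
    have h0 := hc _ (by rw [eL]; exact Sym2.mem_mk_right _ _)
    have h10 := h1 0; have h11 := h1 1; have h00 := h0 0; have h01 := h0 1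
    simp at h10 h11 h00 h01
    have hf1 : f' 1 = -1 := by omega
    by_cases hf0 : f' 0 = -(abCol δ : ℤ) - 1
    · exfalso
      have : f' = ![-(abCol δ : ℤ) - 1, -1] := by funext i; fin_cases i <;> simp [hf0, hf1]
      exact not_isInnerFace_gL hδ hδ' (this ▸ hf')
    · funext i; fin_cases i <;> simp <;> omega

/-- **The tilted data of the unit disc are admissible for `0 < δ < 1/2`.** [folklore] -/
theorem isZdAdmissible_discData : (discData δ).IsZdAdmissible where
  isBounded := isBounded_ball
  delta_pos := hδ
  zdArcA_nonempty := ⟨_, xR1_mem_zdArcA hδ hδ'⟩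
  zdArcB_nonempty := ⟨_, xR0_mem_zdArcB hδ hδ'⟩
  disjoint := Set.disjoint_left.2 fun x hA hB =>
    (mem_zdArcA_of_pos ((discData δ).zdArcA_subset_zdBoundary hA)
      (tilt_pos_of_mem_zdArcA hδ (sq_lt_half hδ hδ') hA)).2 hB
  zdBoundary_subset x hx := by
    rcases lt_trichotomy (tilt δ (meshPoint δ x)) 0 with h | h | h
    · exact Or.inr (mem_zdArcB_of_neg hx h).1
    · exact absurd h (tilt_ne_zero_of_mem_zdBoundary hδ (sq_lt_half hδ hδ') hx)
    · exact Or.inl (mem_zdArcA_of_pos hx h).1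
  ncard_zdABEdges_eq_two := by
    rw [zdABEdges_discData hδ hδ', Set.ncard_pair (eR_ne_eL δ)]
  zdABEdges_inner e he := by
    rw [zdABEdges_discData hδ hδ'] at he
    rcases he with rfl | rfl
    · exact existsUnique_inner_eR hδ hδ'
    · exact existsUnique_inner_eL hδ hδ'

end Admissible

/-! ### The marked points and arcs of the unit disc Dobrushin domain

The next four lemmas are also proved in `Percolation/CanonicalDiscretisationTies.lean`
(namespace `Literature.Probability.Percolation`); they are re-proved here as private one-liners
so as not to import that file's SAW-barrier dependencies into the Ising development. -/

/-- The first marked point of the unit disc Dobrushin domain is `a = 1`. [folklore] -/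
private theorem unitDisc_pt_zero : DobrushinDomain.unitDisc.pt 0 = 1 := by
  simp [MarkedDomain.pt, DobrushinDomain.unitDisc, JordanDomain.unitDisc, circleMap]

/-- The second marked point of the unit disc Dobrushin domain is `b = -1`. [folklore] -/
private theorem unitDisc_pt_one : DobrushinDomain.unitDisc.pt 1 = -1 := by
  have h : DobrushinDomain.unitDisc.pt 1 = circleMap 0 1 (2 * Real.pi * (1 / 2)) := rfl
  rw [h, circleMap]
  have : ((2 * Real.pi * (1 / 2) : ℝ) : ℂ) * Complex.I = Real.pi * Complex.I := by push_cast; ring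
  rw [this, Complex.exp_pi_mul_I]; simp

/-- The mark after the first one is `1/2`. [folklore] -/
private theorem unitDisc_nextMark_zero : DobrushinDomain.unitDisc.nextMark 0 = 1 / 2 := by
  simp [MarkedDomain.nextMark, DobrushinDomain.unitDisc]

/-- The mark after the second one is `0 + 1 = 1` (cyclically). [folklore] -/
private theorem unitDisc_nextMark_one : DobrushinDomain.unitDisc.nextMark 1 = 1 := by
  simp [MarkedDomain.nextMark, DobrushinDomain.unitDisc]

/-- The arc `(ab)` of the unit disc: `{exp (2πit) : t ∈ [0, 1/2]}`. [folklore] -/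
theorem unitDisc_arc_zero : DobrushinDomain.unitDisc.arc 0 =
    (fun t : ℝ ↦ circleMap 0 1 (2 * Real.pi * t)) '' Icc (0 : ℝ) (1 / 2) := by
  rw [MarkedDomain.arc, unitDisc_nextMark_zero]; rfl

/-- The arc `(ba)` of the unit disc: `{exp (2πit) : t ∈ [1/2, 1]}`. [folklore] -/
theorem unitDisc_arc_one : DobrushinDomain.unitDisc.arc 1 =
    (fun t : ℝ ↦ circleMap 0 1 (2 * Real.pi * t)) '' Icc (1 / 2 : ℝ) 1 := by
  rw [MarkedDomain.arc, unitDisc_nextMark_one]; rfl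

/-- `circleMap 0 1 θ = exp (iθ)`. [folklore] -/
theorem circleMap_zero_one (θ : ℝ) : circleMap 0 1 θ = Complex.exp (θ * Complex.I) := by
  simp [circleMap]

/-- Points of the arcs lie on the unit circle. [folklore] -/
theorem norm_eq_one_of_mem_arc {i : Fin 2} {u : ℂ} (hu : u ∈ DobrushinDomain.unitDisc.arc i) :
    ‖u‖ = 1 := by
  have h := DobrushinDomain.unitDisc.arc_subset_frontier i hu
  rw [show DobrushinDomain.unitDisc.carrier = ball (0 : ℂ) 1 from rfl,
    frontier_ball (0 : ℂ) one_ne_zero, mem_sphere_iff_norm, sub_zero] at h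
  exact h

/-- Points of the arc `(ab)` have nonnegative imaginary part. [folklore] -/
theorem im_nonneg_of_mem_arc_zero {u : ℂ} (hu : u ∈ DobrushinDomain.unitDisc.arc 0) : 0 ≤ u.im := by
  rw [unitDisc_arc_zero] at hu
  obtain ⟨t, ht, rfl⟩ := hu
  dsimp only
  rw [circleMap_zero_one, Complex.exp_ofReal_mul_I_im]
  exact Real.sin_nonneg_of_nonneg_of_le_pi (by nlinarith [Real.pi_pos, ht.1])
    (by nlinarith [Real.pi_pos, ht.2])

/-- Points of the arc `(ba)` have nonpositive imaginary part. [folklore] -/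
theorem im_nonpos_of_mem_arc_one {u : ℂ} (hu : u ∈ DobrushinDomain.unitDisc.arc 1) : u.im ≤ 0 := by
  rw [unitDisc_arc_one] at hu
  obtain ⟨t, ht, rfl⟩ := hu
  dsimp only
  rw [circleMap_zero_one, Complex.exp_ofReal_mul_I_im, ← Real.sin_sub_two_pi]
  exact Real.sin_nonpos_of_nonpos_of_neg_pi_le (by nlinarith [Real.pi_pos, ht.2])
    (by nlinarith [Real.pi_pos, ht.1])

/-- A point of the closed upper half circle lies on the arc `(ab)`. [folklore] -/
theorem mem_arc_zero_of {w : ℂ} (hw : ‖w‖ = 1) (him : 0 ≤ w.im) :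
    w ∈ DobrushinDomain.unitDisc.arc 0 := by
  rw [unitDisc_arc_zero]
  refine ⟨Complex.arg w / (2 * Real.pi), ⟨?_, ?_⟩, ?_⟩
  · exact div_nonneg (Complex.arg_nonneg_iff.2 him) (by positivity)
  · rw [div_le_iff₀ (by positivity)]
    have := Complex.arg_le_pi w; linarith
  · simp only
    rw [circleMap_zero_one, mul_div_cancel₀ _ (by positivity : (2 * Real.pi : ℝ) ≠ 0)]
    have := Complex.norm_mul_exp_arg_mul_I w
    rw [hw, Complex.ofReal_one, one_mul] at this
    exact this

/-- A point of the closed lower half circle lies on the arc `(ba)`. [folklore] -/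
theorem mem_arc_one_of {w : ℂ} (hw : ‖w‖ = 1) (him : w.im ≤ 0) :
    w ∈ DobrushinDomain.unitDisc.arc 1 := by
  rw [unitDisc_arc_one]
  have key : ∀ θ : ℝ, Complex.exp (((2 * Real.pi * (1 + θ / (2 * Real.pi)) : ℝ) : ℂ) * Complex.I) =
      Complex.exp ((θ : ℂ) * Complex.I) := by
    intro θ
    have : (((2 * Real.pi * (1 + θ / (2 * Real.pi)) : ℝ) : ℂ) * Complex.I) =
        (θ : ℂ) * Complex.I + 2 * Real.pi * Complex.I := by
      rw [mul_add, mul_div_cancel₀ _ (by positivity : (2 * Real.pi : ℝ) ≠ 0)]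
      push_cast; ring
    rw [this, Complex.exp_add, Complex.exp_two_pi_mul_I, mul_one]
  rcases him.lt_or_eq with hlt | heq
  · -- `im w < 0`: `arg w ∈ (-π, 0)`, parameter `1 + arg w / (2π) ∈ (1/2, 1)`
    have h1 : Complex.arg w < 0 := Complex.arg_neg_iff.2 hlt
    have h2 := Complex.neg_pi_lt_arg w
    refine ⟨1 + Complex.arg w / (2 * Real.pi), ⟨?_, ?_⟩, ?_⟩
    · have : -(1 / 2 : ℝ) < Complex.arg w / (2 * Real.pi) := by
        rw [lt_div_iff₀ (by positivity)]; linarith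
      linarith
    · have : Complex.arg w / (2 * Real.pi) ≤ 0 :=
        div_nonpos_of_nonpos_of_nonneg h1.le (by positivity)
      linarith
    · simp only
      rw [circleMap_zero_one, key]
      have := Complex.norm_mul_exp_arg_mul_I w
      rw [hw, Complex.ofReal_one, one_mul] at this
      exact this
  · -- `im w = 0`: `w = 1` (parameter `1`) or `w = -1` (parameter `1/2`)
    have hre : w.re * w.re = 1 := by
      have : ‖w‖ ^ 2 = w.re * w.re + w.im * w.im := by rw [Complex.sq_norm, Complex.normSq_apply]
      rw [hw, heq] at this; linarith
    rcases mul_self_eq_one_iff.1 hre with h | h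
    · refine ⟨1, ⟨by norm_num, le_rfl⟩, ?_⟩
      simp only [mul_one]
      rw [circleMap_zero_one]
      have : w = 1 := Complex.ext (by simp [h]) (by simp [heq])
      rw [this]
      exact_mod_cast Complex.exp_two_pi_mul_I
    · refine ⟨1 / 2, ⟨le_rfl, by norm_num⟩, ?_⟩
      simp only
      rw [circleMap_zero_one]
      have : w = -1 := Complex.ext (by simp [h]) (by simp [heq])
      rw [this]
      have e : (((2 * Real.pi * (1 / 2)) : ℝ) : ℂ) * Complex.I = Real.pi * Complex.I := by
        push_cast; ring
      rw [e, Complex.exp_pi_mul_I]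

/-! ### Hausdorff distance of the tilted arcs to the half circles -/

/-- On the unit circle, `‖w + 1‖ ≤ 2c` if `re w ≤ 0` and `|im w| ≤ c`. [folklore] -/
theorem norm_add_one_le {w : ℂ} (hw : ‖w‖ = 1) (hre : w.re ≤ 0) {c : ℝ} (hc : 0 ≤ c)
    (him : |w.im| ≤ c) : ‖w + 1‖ ≤ 2 * c := by
  have h1 : w.re * w.re + w.im * w.im = 1 := by
    have : ‖w‖ ^ 2 = w.re * w.re + w.im * w.im := by rw [Complex.sq_norm, Complex.normSq_apply]
    rw [hw] at this; linarith
  have h2 : ‖w + 1‖ ^ 2 = (w.re + 1) * (w.re + 1) + w.im * w.im := by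
    rw [Complex.sq_norm, Complex.normSq_apply]; simp
  have him2 : w.im * w.im ≤ c * c := by
    have := abs_le.1 him
    nlinarith [abs_nonneg w.im]
  have h3 : ‖w + 1‖ ^ 2 ≤ (2 * c) ^ 2 := by
    rw [h2]
    -- `0 ≤ re + 1 ≤ im²` (as `(1 + re)(1 - re) = im²`, `1 - re ≥ 1`), and `im² ≤ 1`
    have hre1 : -1 ≤ w.re := by nlinarith
    have h4 : w.re + 1 ≤ w.im * w.im := by nlinarith
    have h5 : w.im * w.im ≤ 1 := by nlinarith
    nlinarith
  exact le_of_pow_le_pow_left₀ two_ne_zero (by positivity) h3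

/-- On the unit circle, `‖w - 1‖ ≤ 2c` if `0 ≤ re w` and `|im w| ≤ c`. [folklore] -/
theorem norm_sub_one_le {w : ℂ} (hw : ‖w‖ = 1) (hre : 0 ≤ w.re) {c : ℝ} (hc : 0 ≤ c)
    (him : |w.im| ≤ c) : ‖w - 1‖ ≤ 2 * c := by
  have h := norm_add_one_le (w := -w) (by rwa [norm_neg]) (by simpa using hre) hc (by simpa using him)
  rwa [show -w + 1 = -(w - 1) by ring, norm_neg] at h

/-- The point `w₀ = ((4 - δ²) + 4δ i)/(4 + δ²)` of the unit circle, on the tilt line side of `A`,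
within `δ` of `1`. [folklore] -/
def w₀ (δ : ℝ) : ℂ := ⟨(4 - δ ^ 2) / (4 + δ ^ 2), 4 * δ / (4 + δ ^ 2)⟩

/-- `w₀` lies on the unit circle (`(4 - δ²)² + (4δ)² = (4 + δ²)²`). [folklore] -/
theorem norm_w₀ (δ : ℝ) : ‖w₀ δ‖ = 1 := by
  have hpos : 0 < 4 + δ ^ 2 := by positivity
  have h : ‖w₀ δ‖ ^ 2 = 1 := by
    rw [Complex.sq_norm, Complex.normSq_apply, w₀]
    field_simp
    ring
  exact (pow_eq_one_iff_of_nonneg (norm_nonneg _) two_ne_zero).1 h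

/-- `w₀` lies on the `A` side of the tilt line (`0 ≤ δ`). [folklore] -/
theorem tilt_w₀_nonneg {δ : ℝ} (hδ : 0 ≤ δ) : 0 ≤ tilt δ (w₀ δ) := by
  have hpos : 0 < 4 + δ ^ 2 := by positivity
  rw [tilt, w₀]
  simp only
  rw [show 4 * δ / (4 + δ ^ 2) - δ / 2 * ((4 - δ ^ 2) / (4 + δ ^ 2)) =
    (2 * δ + δ ^ 3 / 2) / (4 + δ ^ 2) by field_simp; ring]
  positivity

/-- `w₀` is within `δ` of `1` (`‖1 - w₀‖² = 4δ²/(4 + δ²)`). [folklore] -/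
theorem norm_one_sub_w₀_le {δ : ℝ} (hδ : 0 ≤ δ) : ‖1 - w₀ δ‖ ≤ δ := by
  have hpos : 0 < 4 + δ ^ 2 := by positivity
  have h : ‖1 - w₀ δ‖ ^ 2 ≤ δ ^ 2 := by
    rw [Complex.sq_norm, Complex.normSq_apply, w₀]
    simp only [Complex.sub_re, Complex.one_re, Complex.sub_im, Complex.one_im]
    rw [show (1 - (4 - δ ^ 2) / (4 + δ ^ 2)) * (1 - (4 - δ ^ 2) / (4 + δ ^ 2)) +
      (0 - 4 * δ / (4 + δ ^ 2)) * (0 - 4 * δ / (4 + δ ^ 2)) = 4 * δ ^ 2 / (4 + δ ^ 2) by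
      field_simp; ring]
    rw [div_le_iff₀ hpos]; nlinarith [sq_nonneg δ]
  exact le_of_pow_le_pow_left₀ two_ne_zero hδ h

/-- **The tilted upper arc is within Hausdorff distance `2δ` of the upper half circle.**
[folklore] -/
theorem hausdorffEDist_tiltUp_le {δ : ℝ} (hδ : 0 < δ) :
    hausdorffEDist (tiltUp δ) (DobrushinDomain.unitDisc.arc 0) ≤ ENNReal.ofReal (2 * δ) := by
  refine hausdorffEDist_le_of_mem_edist ?_ ?_
  · rintro w ⟨hw, ht⟩
    rcases le_or_gt 0 w.im with him | him
    · exact ⟨w, mem_arc_zero_of hw him, by simp⟩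
    · -- `im w < 0 ≤ tilt`: `re w < 0`, `|im w| ≤ δ/2`, so `w` is within `δ` of `-1`
      refine ⟨-1, mem_arc_zero_of (by simp) (by simp), ?_⟩
      rw [edist_dist, dist_eq_norm, sub_neg_eq_add]
      refine ENNReal.ofReal_le_ofReal ?_
      rw [tilt] at ht
      have hre : w.re ≤ 0 := by nlinarith
      have hre1 : -1 ≤ w.re := by
        have := Complex.abs_re_le_norm w; rw [hw] at this; exact (abs_le.1 this).1
      have habs : |w.im| ≤ δ / 2 := by
        rw [abs_of_neg him]; nlinarith
      have := norm_add_one_le hw hre (by positivity) habs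
      linarith
  · intro u hu
    have hu1 := norm_eq_one_of_mem_arc hu
    have him := im_nonneg_of_mem_arc_zero hu
    rcases le_or_gt 0 (tilt δ u) with ht | ht
    · exact ⟨u, ⟨hu1, ht⟩, by simp⟩
    · -- `0 ≤ im u < (δ/2) re u`: `u` within `δ` of `1`, and `1` within `δ` of `w₀ ∈ tiltUp`
      refine ⟨w₀ δ, ⟨norm_w₀ δ, tilt_w₀_nonneg hδ.le⟩, ?_⟩
      rw [edist_dist]
      refine ENNReal.ofReal_le_ofReal ?_
      rw [tilt] at ht
      have hre1 : u.re ≤ 1 := by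
        have := Complex.abs_re_le_norm u; rw [hu1] at this; exact (abs_le.1 this).2
      have hre : 0 ≤ u.re := by nlinarith
      have habs : |u.im| ≤ δ / 2 := by
        rw [abs_of_nonneg him]; nlinarith
      calc dist u (w₀ δ) ≤ dist u 1 + dist 1 (w₀ δ) := dist_triangle _ _ _
        _ ≤ 2 * (δ / 2) + δ := by
          rw [dist_eq_norm, dist_eq_norm]
          exact add_le_add (norm_sub_one_le hu1 hre (by positivity) habs) (norm_one_sub_w₀_le hδ.le)
        _ = 2 * δ := by ring

/-- **The tilted lower arc is within Hausdorff distance `2δ` of the lower half circle.**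
[folklore] -/
theorem hausdorffEDist_tiltLo_le {δ : ℝ} (hδ : 0 < δ) :
    hausdorffEDist (tiltLo δ) (DobrushinDomain.unitDisc.arc 1) ≤ ENNReal.ofReal (2 * δ) := by
  refine hausdorffEDist_le_of_mem_edist ?_ ?_
  · rintro w ⟨hw, ht⟩
    rcases le_or_gt w.im 0 with him | him
    · exact ⟨w, mem_arc_one_of hw him, by simp⟩
    · -- `tilt ≤ 0 < im w`: `re w > 0`, `|im w| ≤ δ/2`, so `w` is within `δ` of `1`
      refine ⟨1, mem_arc_one_of (by simp) (by simp), ?_⟩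
      rw [edist_dist, dist_eq_norm]
      refine ENNReal.ofReal_le_ofReal ?_
      rw [tilt] at ht
      have hre1 : w.re ≤ 1 := by
        have := Complex.abs_re_le_norm w; rw [hw] at this; exact (abs_le.1 this).2
      have hre : 0 ≤ w.re := by nlinarith
      have habs : |w.im| ≤ δ / 2 := by
        rw [abs_of_pos him]; nlinarith
      have := norm_sub_one_le hw hre (by positivity) habs
      linarith
  · intro u hu
    have hu1 := norm_eq_one_of_mem_arc hu
    have him := im_nonpos_of_mem_arc_one hu
    rcases le_or_gt (tilt δ u) 0 with ht | ht
    · exact ⟨u, ⟨hu1, ht⟩, by simp⟩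
    · -- `(δ/2) re u < im u ≤ 0`: `u` within `δ` of `-1`, and `-1` within `δ` of `-w₀ ∈ tiltLo`
      have hn : ‖-w₀ δ‖ = 1 := by rw [norm_neg, norm_w₀]
      have ht0 : tilt δ (-w₀ δ) ≤ 0 := by
        rw [tilt_neg]; exact neg_nonpos.2 (tilt_w₀_nonneg hδ.le)
      refine ⟨-w₀ δ, ⟨hn, ht0⟩, ?_⟩
      rw [edist_dist]
      refine ENNReal.ofReal_le_ofReal ?_
      rw [tilt] at ht
      have hre1 : -1 ≤ u.re := by
        have := Complex.abs_re_le_norm u; rw [hu1] at this; exact (abs_le.1 this).1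
      have hre : u.re ≤ 0 := by nlinarith
      have habs : |u.im| ≤ δ / 2 := by
        rw [abs_of_nonpos him]; nlinarith
      calc dist u (-w₀ δ) ≤ dist u (-1) + dist (-1) (-w₀ δ) := dist_triangle _ _ _
        _ ≤ 2 * (δ / 2) + δ := by
          rw [dist_neg_neg, dist_eq_norm, dist_eq_norm, sub_neg_eq_add]
          exact add_le_add (norm_add_one_le hu1 hre (by positivity) habs) (norm_one_sub_w₀_le hδ.le)
        _ = 2 * δ := by ring


/-! ### The discrete marked points converge to `±1` -/

/-- Real part of the right discrete marked point: `δM`. [folklore] -/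
theorem medialPoint_eR_re (δ : ℝ) : (medialPoint δ (eR δ)).re = δ * abCol δ := by
  simp [eR, meshPoint_re]

/-- Imaginary part of the right discrete marked point: `δ/2`. [folklore] -/
theorem medialPoint_eR_im (δ : ℝ) : (medialPoint δ (eR δ)).im = δ / 2 := by
  simp [eR, meshPoint_im]

/-- Real part of the left discrete marked point: `-δM`. [folklore] -/
theorem medialPoint_eL_re (δ : ℝ) : (medialPoint δ (eL δ)).re = -(δ * abCol δ) := by
  simp [eL, meshPoint_re]

/-- Imaginary part of the left discrete marked point: `-δ/2`. [folklore] -/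
theorem medialPoint_eL_im (δ : ℝ) : (medialPoint δ (eL δ)).im = -(δ / 2) := by
  simp [eL, meshPoint_im]; ring

section Marks

variable {δ : ℝ} (hδ : 0 < δ) (hδ' : δ < 1 / 2)
include hδ hδ'

/-- `1 - 2δ ≤ δ M`. [folklore] -/
theorem one_sub_le_mul_abCol : 1 - 2 * δ ≤ δ * abCol δ := by
  have h := one_le_sq_abCol_succ hδ hδ'
  have hX : 0 ≤ δ * ((abCol δ : ℝ) + 1) := by positivity
  by_contra hcon
  have h1 : 0 < 1 - δ - δ * ((abCol δ : ℝ) + 1) := by linarith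
  have h2 : 0 < 1 - δ + δ * ((abCol δ : ℝ) + 1) := by linarith
  nlinarith [mul_pos h1 h2]

/-- `δ M < 1`. [folklore] -/
theorem mul_abCol_lt_one : δ * abCol δ < 1 := by
  have h := sq_abCol_lt hδ hδ'
  have hX : 0 ≤ δ * (abCol δ : ℝ) := by positivity
  nlinarith

/-- The right discrete marked point `δM + iδ/2` is within `3δ` of `a = 1`. [folklore] -/
theorem dist_medialPoint_eR_le : dist (medialPoint δ (eR δ)) 1 ≤ 3 * δ := by
  rw [dist_eq_norm]
  refine (Complex.norm_le_abs_re_add_abs_im _).trans ?_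
  rw [Complex.sub_re, Complex.sub_im, medialPoint_eR_re, medialPoint_eR_im,
    Complex.one_re, Complex.one_im, sub_zero]
  have h1 := one_sub_le_mul_abCol hδ hδ'
  have h2 := mul_abCol_lt_one hδ hδ'
  rw [abs_of_nonpos (by linarith), abs_of_pos (by linarith)]
  linarith

/-- The left discrete marked point `-δM - iδ/2` is within `3δ` of `b = -1`. [folklore] -/
theorem dist_medialPoint_eL_le : dist (medialPoint δ (eL δ)) (-1) ≤ 3 * δ := by
  rw [dist_eq_norm, sub_neg_eq_add]
  refine (Complex.norm_le_abs_re_add_abs_im _).trans ?_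
  rw [Complex.add_re, Complex.add_im, medialPoint_eL_re, medialPoint_eL_im,
    Complex.one_re, Complex.one_im, add_zero]
  have h1 := one_sub_le_mul_abCol hδ hδ'
  have h2 := mul_abCol_lt_one hδ hδ'
  rw [abs_of_nonneg (by linarith), abs_of_neg (by linarith)]
  linarith

/-- **The discrete marked points are within Hausdorff distance `3δ` of `{a, b} = {1, -1}`.**
[folklore] -/
theorem hausdorffEDist_medialPoint_le :
    hausdorffEDist (medialPoint δ '' (discData δ).zdABEdges)
      {DobrushinDomain.unitDisc.pt 0, DobrushinDomain.unitDisc.pt 1} ≤ ENNReal.ofReal (3 * δ) := by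
  rw [zdABEdges_discData hδ hδ', image_pair, unitDisc_pt_zero, unitDisc_pt_one]
  have hR := dist_medialPoint_eR_le hδ hδ'
  have hL := dist_medialPoint_eL_le hδ hδ'
  refine hausdorffEDist_le_of_mem_edist ?_ ?_
  · rintro x (rfl | rfl)
    · exact ⟨1, mem_insert _ _, by rw [edist_dist]; exact ENNReal.ofReal_le_ofReal hR⟩
    · refine ⟨-1, mem_insert_of_mem _ (mem_singleton _), ?_⟩
      rw [edist_dist]
      exact ENNReal.ofReal_le_ofReal hL
  · rintro y (rfl | rfl)
    · exact ⟨_, mem_insert _ _, by rw [edist_dist, dist_comm]; exact ENNReal.ofReal_le_ofReal hR⟩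
    · refine ⟨_, mem_insert_of_mem _ (mem_singleton _), ?_⟩
      rw [edist_dist, dist_comm]
      exact ENNReal.ofReal_le_ofReal hL

end Marks

/-! ### The discretisation of the unit disc -/

/-- Squeeze: a nonnegative `ℝ≥0∞`-valued function bounded by `C δ` for `0 < δ < 1/2` tends to `0`
as `δ → 0⁺`. [folklore] -/
theorem tendsto_zero_of_le {f : ℝ → ENNReal} {C : ℝ}
    (h : ∀ δ, 0 < δ → δ < 1 / 2 → f δ ≤ ENNReal.ofReal (C * δ)) :
    Tendsto f (𝓝[>] 0) (𝓝 0) := by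
  have hg : Tendsto (fun δ : ℝ => ENNReal.ofReal (C * δ)) (𝓝[>] 0) (𝓝 0) := by
    have h1 : Tendsto (fun δ : ℝ => C * δ) (𝓝 0) (𝓝 0) := by
      simpa using (tendsto_const_nhds (x := C)).mul (Filter.tendsto_id (x := 𝓝 (0 : ℝ)))
    have h2 := ENNReal.tendsto_ofReal (tendsto_nhdsWithin_of_tendsto_nhds (s := Ioi 0) h1)
    rwa [ENNReal.ofReal_zero] at h2
  refine tendsto_of_tendsto_of_tendsto_of_le_of_le' tendsto_const_nhds hg
    (Eventually.of_forall fun _ => zero_le) ?_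
  filter_upwards [Ioo_mem_nhdsGT (show (0 : ℝ) < 1 / 2 by norm_num)] with δ hδ'
  exact h δ hδ'.1 hδ'.2

/-- **The tilted data discretise the unit disc Dobrushin domain** (`IsDiscretisation` in the
sense of `InterfaceSLE.lean`: canonical vertex set `𝔻_δ`, mesh `δ`, arcs converging to the half
circles, discrete marked points converging to `{1, -1}`, admissible for all `δ ∈ (0, 1/2)`);
cf. CDHKS 2014, §1 (discrete domains `(Ω_δ; a_δ, b_δ)` approximating `(Ω; a, b)`). Elementary.
[folklore] -/
theorem isDiscretisation_discData : IsDiscretisation DobrushinDomain.unitDisc discData where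
  Ω_eq _ := rfl
  δ_eq _ := rfl
  tendsto_arcA := tendsto_zero_of_le (C := 2) fun δ hδ _ => hausdorffEDist_tiltUp_le hδ
  tendsto_arcB := tendsto_zero_of_le (C := 2) fun δ hδ _ => hausdorffEDist_tiltLo_le hδ
  tendsto_zdABEdges := tendsto_zero_of_le (C := 3) fun δ hδ hδ' =>
    hausdorffEDist_medialPoint_le hδ hδ'
  eventually_isZdAdmissible := by
    filter_upwards [Ioo_mem_nhdsGT (show (0 : ℝ) < 1 / 2 by norm_num)] with δ hδ
    exact isZdAdmissible_discData hδ.1 hδ.2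

end UnitDiscDiscretisation

open UnitDiscDiscretisation in
/-- **`IsDiscretisation` is satisfiable**: the unit disc Dobrushin domain admits a family of
admissible square-lattice discretisations. Hence the S17 statements
`convergesInLawToSLE_three_isingInterface`, `convergesInLawToSLE_sixteen_thirds_fkInterface`,
Smirnov's theorem in the form
`fkIsingObservable_tendstoLocallyUniformlyOn_sqrt_deriv_of_isDiscretisation` and
`SLE6LimitZ2AllDiscretisations` are not vacuous in their domain hypotheses (cf. CDHKS 2014, §1).
[folklore] -/
theorem exists_isDiscretisation :
    ∃ (D : RandomPlanarGeometry.DobrushinDomain) (E : ℝ → DiscreteDobrushin), IsDiscretisation D E :=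
  ⟨_, _, isDiscretisation_discData⟩

open UnitDiscDiscretisation in
/-- **A concrete instance of crit-ising.S17 (FK side).** The named fact
`convergesInLawToSLE_sixteen_thirds_fkInterface` (CDHKS 2014, Thm. 2) entails the convergence in
law to chordal SLE_{16/3} of the critical FK-Ising interfaces of the explicit admissible
discretisations `discData δ` of the unit disc from `1` to `-1`: the fact has genuine content.
(CDHKS 2014, Thm. 2.) [cite: CDHKSCRAS2014, Thm. 2] -/
theorem convergesInLawToSLE_fkInterface_unitDisc (h : convergesInLawToSLE_sixteen_thirds_fkInterface) :
    RandomPlanarGeometry.ConvergesInLawToSLE (16 / 3) DobrushinDomain.unitDisc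
      (Ωδ := fun _ => Percolation.BondConfig (Site 2))
      (fun δ => fkInterfaceCurve DobrushinDomain.unitDisc (discData δ))
      (fun δ => fkDobrushinMeasure (discData δ)) :=
  h DobrushinDomain.unitDisc discData isDiscretisation_discData

-- names the `@[deprecated]` record `convergesInLawToSLE_three_isingInterface` of `InterfaceSLE.lean` on
-- purpose: this IS that (misstated) statement specialised to the unit disc (verdict clean-up
-- 2026-08-16; corrected statement: `convergesInLawToSLE_three_isingInterface_zd`, `InterfaceSLEProofs.lean`);
-- REMOVE-WHEN the record is deleted from `InterfaceSLE.lean` (then delete this theorem)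
set_option linter.deprecated false in
open UnitDiscDiscretisation in
/-- **A concrete instance of the (misstated, now `@[deprecated]`) spin side of crit-ising.S17.** The
record `convergesInLawToSLE_three_isingInterface` (misstated rendering of CDHKS 2014, Thm. 1: its
measure `isingDobrushinMeasure` leaves the concave lattice corners of `Ω_δ` thermal while the
interface predicate reads them as frozen; corrected statement
`convergesInLawToSLE_three_isingInterface_zd` in `InterfaceSLEProofs.lean`) entails, for every family of
interface-selection rules (such families always exist: `exists_forall_isInterfaceSelection` in
`InterfaceSLEAssembly.lean`), the convergence in law to chordal SLE₃ of the critical Ising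
interfaces of the explicit admissible discretisations `discData δ` of the unit disc.
(CDHKS 2014, Thm. 1.) [cite: CDHKSCRAS2014, Thm. 1] -/
theorem convergesInLawToSLE_isingInterface_unitDisc (h : convergesInLawToSLE_three_isingInterface)
    (sel : ℝ → SpinConfig (Site 2) → List (Sym2 (Site 2)))
    (hsel : ∀ δ, IsInterfaceSelection (discData δ) (sel δ)) :
    RandomPlanarGeometry.ConvergesInLawToSLE 3 DobrushinDomain.unitDisc
      (Ωδ := fun _ => SpinConfig (Site 2))
      (fun δ σ => spinInterfaceCurve DobrushinDomain.unitDisc δ (sel δ σ))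
      (fun δ => isingDobrushinMeasure (discData δ) criticalBetaTwo) :=
  h DobrushinDomain.unitDisc discData isDiscretisation_discData sel hsel

end Literature.Probability.LatticeModels
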